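import Summits.CriticalPhenomena.Ising3DConformalLimit.Theorems.EnergyNotSigmaSquaredMoebiusLimitExistsClusterMoveIneq
import Summits.CriticalPhenomena.Ising3DConformalLimit.Theorems.EnergyNotSigmaSquaredMoebiusLimitExistsDoubledThickening
import Summits.CriticalPhenomena.Ising3DConformalLimit.Theorems.EnergyNotSigmaSquaredMoebiusLimitExistsPedigreeAssembly
import Summits.CriticalPhenomena.Ising3DConformalLimit.Theorems.MoebiusLimitExists.Negative.RatioRegular
import Mathlib.Topology.MetricSpace.Thickening
import HarnessLib
import HarnessLib.Audit
import Summits.CriticalPhenomena.Ising3DConformalLimit.Theorems.EnergyNotSigmaSquaredMoebiusLimitExistsCompactnessSchema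
import Summits.CriticalPhenomena.Ising3DConformalLimit.Theorems.EnergyNotSigmaSquaredMoebiusLimitExistsLocallyBounded
import Summits.CriticalPhenomena.Ising3DConformalLimit.Theorems.EnergyNotSigmaSquaredMoebiusLimitExistsTranslationInvariant
import Summits.CriticalPhenomena.Ising3DConformalLimit.Theorems.EnergyNotSigmaSquaredMoebiusLimitExistsEquicontinuousTwo
import Summits.CriticalPhenomena.Ising3DConformalLimit.Theorems.EnergyNotSigmaSquaredMoebiusLimitExistsTelescoping
import Summits.CriticalPhenomena.Ising3DConformalLimit.Theorems.EnergyNotSigmaSquaredMoebiusLimitExistsPedigreeMono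
import Summits.CriticalPhenomena.Ising3DConformalLimit.Theorems.EnergyNotSigmaSquaredMoebiusLimitExistsPedigreeCovering
import Summits.CriticalPhenomena.Ising3DConformalLimit.Theorems.EnergyNotSigmaSquaredMoebiusLimitExistsPedigreeCover
import Summits.CriticalPhenomena.Ising3DConformalLimit.Theorems.EnergyNotSigmaSquaredMoebiusLimitExistsSVEquicontTransport
import Summits.CriticalPhenomena.Ising3DConformalLimit.Theses.PerfectScreening
import Summits.CriticalPhenomena.Ising3DConformalLimit.Theses.EnergyNotSigmaSquared
import Summits.CriticalPhenomena.Ising3DConformalLimit.Theses.IsingEuclidUpgrade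
import Summits.CriticalPhenomena.Ising3DConformalLimit.Theorems.MoebiusLimitExists.Negative.DeltaWindow
import Summits.CriticalPhenomena.Ising3DConformalLimit.Theorems.MoebiusLimitExists.Negative.CruxInversionOnly
import Summits.CriticalPhenomena.Ising3DConformalLimit.Theorems.EnergyNotSigmaSquaredMoebiusLimitExistsPinnedTwoPoint
import Summits.CriticalPhenomena.Ising3DConformalLimit.Theorems.EnergyNotSigmaSquaredMoebiusLimitExistsFreeClusterPointWick
import Summits.CriticalPhenomena.Ising3DConformalLimit.Theorems.EnergyNotSigmaSquaredMoebiusLimitExistsWickPowerMoebius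
import Literature.Barriers.CriticalPhenomena.BootstrapLatticeBlindness
import Summits.CriticalPhenomena.Ising3DConformalLimit.Theses.HyperoctahedralRP
import Summits.CriticalPhenomena.Ising3DConformalLimit.Theorems.HyperoctahedralRPHRP2Rigidity
import Summits.CriticalPhenomena.Ising3DConformalLimit.Theorems.MoebiusLimitExists.Negative.PinnedClusterPoints
import Summits.CriticalPhenomena.Ising3DConformalLimit.Theorems.MoebiusLimitExists.Negative.ScaleRedundant

noncomputable section

open Filter Topology Set Function Metric
open Literature.Probability.LatticeModels Literature.Barriers.CriticalPhenomena

namespace Summit.CriticalPhenomena.Ising3DConformalLimit.MoebiusLimitExistsOnlyInteraction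


open Summit.CriticalPhenomena.Ising3DConformalLimit.MoebiusLimitExistsNegative
  (norm_le_two_mul_of_abs_le abs_apply_le_norm)

/-! ### Lifts of lattice configurations -/

/-- The pinned zoom at the lift `j ↦ δ • Y j` of a lattice configuration is `ρ_pin(δ)^m ⟨∏σ_Y⟩`
(`[δ y/δ] = y`). [folklore] -/
theorem rescaledCorrelator_lift_ps {δ : ℝ} (hδ : 0 < δ) {m : ℕ} (Y : Fin m → Site 3) :
    rescaledCorrelator (criticalCorr 3) rhoPin m δ (fun j => (δ • siteVec (Y j) : EuclideanSpace ℝ (Fin 3))) =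
      rhoPin δ ^ m * criticalCorr 3 m Y := by
  rw [rescaledCorrelator_apply]
  simp only [latticeApprox_smul_siteVec hδ]

/-- **Registered anchor of this helper file** (`liftZoom_ps`): the pinned zoom at the lift
`j ↦ δ • Y j` of a lattice configuration `Y` is `ρ_pin(δ)^m ⟨∏σ_Y⟩`, explicit-binder form of
`rescaledCorrelator_lift_ps`. [folklore] -/
theorem liftZoom_ps :
    ∀ (δ : ℝ), 0 < δ → ∀ (m : ℕ) (Y : Fin m → Site 3),
      rescaledCorrelator (criticalCorr 3) rhoPin m δ (fun j => δ • siteVec (Y j)) =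
        rhoPin δ ^ m * criticalCorr 3 m Y :=
  fun _ hδ _ Y => rescaledCorrelator_lift_ps hδ Y

/-- `‖δ [p/δ] − p‖₂ ≤ 2δ` (each coordinate is off by at most `δ`). [folklore] -/
theorem norm_lift_latticeApprox_sub_le_ps {δ : ℝ} (hδ : 0 < δ) (p : EuclideanSpace ℝ (Fin 3)) :
    ‖(δ • siteVec (latticeApprox δ p) : EuclideanSpace ℝ (Fin 3)) - p‖ ≤ 2 * δ := by
  refine norm_le_two_mul_of_abs_le fun i => ?_
  rw [PiLp.sub_apply, PiLp.smul_apply, siteVec_apply, smul_eq_mul]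
  exact abs_mul_latticeApprox_sub_le hδ p i

/-- `‖δ [q/δ] − p‖₂ ≤ 2δ + dist q p`. [folklore] -/
theorem norm_lift_latticeApprox_sub_le'_ps {δ : ℝ} (hδ : 0 < δ) (p q : EuclideanSpace ℝ (Fin 3)) :
    ‖(δ • siteVec (latticeApprox δ q) : EuclideanSpace ℝ (Fin 3)) - p‖ ≤ 2 * δ + dist q p := by
  have h := norm_sub_le ((δ • siteVec (latticeApprox δ q) : EuclideanSpace ℝ (Fin 3)) - q) (p - q)
  rw [sub_sub_sub_cancel_right] at h
  have h1 := norm_lift_latticeApprox_sub_le_ps hδ q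
  have h2 : ‖p - q‖ = dist q p := by rw [dist_comm, dist_eq_norm]
  linarith

/-- `rdotZ g (δ y) = δ (g·y)`. [folklore] -/
theorem rdotZ_smul_siteVec_ps (g : Site 3) (δ : ℝ) (y : Site 3) :
    rdotZ g (δ • siteVec y) = δ * zdot g y := by
  simp only [rdotZ, PiLp.smul_apply, siteVec_apply, smul_eq_mul, zdot, Int.cast_add, Int.cast_mul]
  ring

/-- `|δ g·[p/δ] − rdotZ g p| ≤ 4δ` for a cubic direction `g`. [folklore] -/
theorem abs_mul_zdot_latticeApprox_sub_le_ps {g : Site 3} (hg : IsCubicDir g) {δ : ℝ} (hδ : 0 < δ)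
    (p : EuclideanSpace ℝ (Fin 3)) : |δ * zdot g (latticeApprox δ p) - rdotZ g p| ≤ 4 * δ := by
  rw [← rdotZ_smul_siteVec_ps]
  refine (abs_rdotZ_sub_le_pa hg _ _).trans ?_
  rw [dist_eq_norm]
  linarith [norm_lift_latticeApprox_sub_le_ps hδ p]

/-- Lattice side condition BELOW the mirror: if `rdotZ g p + κ ≤ T` and `4δ ≤ κ` then
`g·[p/δ] ≤ ⌊T/δ⌋`. [folklore] -/
theorem zdot_latticeApprox_le_floor_ps {g : Site 3} (hg : IsCubicDir g) {δ κ T : ℝ} (hδ : 0 < δ)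
    (hκ : 4 * δ ≤ κ) {p : EuclideanSpace ℝ (Fin 3)} (h : rdotZ g p + κ ≤ T) :
    zdot g (latticeApprox δ p) ≤ ⌊T / δ⌋ := by
  have h1 := (abs_le.1 (abs_mul_zdot_latticeApprox_sub_le_ps hg hδ p)).2
  have h2 : T < δ * ((⌊T / δ⌋ : ℤ) + 1 : ℝ) := by
    have := Int.lt_floor_add_one (T / δ)
    rwa [div_lt_iff₀ hδ, mul_comm] at this
  have h3 : δ * (zdot g (latticeApprox δ p) : ℝ) < δ * ((⌊T / δ⌋ : ℤ) + 1 : ℝ) := by linarith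
  have h4 : (zdot g (latticeApprox δ p) : ℝ) < (⌊T / δ⌋ : ℤ) + 1 := lt_of_mul_lt_mul_left h3 hδ.le
  have h5 : zdot g (latticeApprox δ p) < ⌊T / δ⌋ + 1 := by exact_mod_cast h4
  omega

/-- Lattice side condition ABOVE the mirror: if `T + κ ≤ rdotZ g p` and `4δ ≤ κ` then
`⌊T/δ⌋ ≤ g·[p/δ]`. [folklore] -/
theorem floor_le_zdot_latticeApprox_ps {g : Site 3} (hg : IsCubicDir g) {δ κ T : ℝ} (hδ : 0 < δ)
    (hκ : 4 * δ ≤ κ) {p : EuclideanSpace ℝ (Fin 3)} (h : T + κ ≤ rdotZ g p) :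
    ⌊T / δ⌋ ≤ zdot g (latticeApprox δ p) := by
  have h1 := (abs_le.1 (abs_mul_zdot_latticeApprox_sub_le_ps hg hδ p)).1
  have h2 : δ * ((⌊T / δ⌋ : ℤ) : ℝ) ≤ T := by
    have := Int.floor_le (T / δ)
    rwa [le_div_iff₀ hδ, mul_comm] at this
  have h3 : δ * ((⌊T / δ⌋ : ℤ) : ℝ) ≤ δ * (zdot g (latticeApprox δ p) : ℝ) := by linarith
  exact_mod_cast le_of_mul_le_mul_left h3 hδ

/-- `0 ≤ T − δ⌊T/δ⌋ ≤ δ`, as `|δ⌊T/δ⌋ − T| ≤ δ`. [folklore] -/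
theorem abs_mul_floor_sub_le_ps {δ : ℝ} (hδ : 0 < δ) (T : ℝ) : |δ * ((⌊T / δ⌋ : ℤ) : ℝ) - T| ≤ δ := by
  have h1 : δ * ((⌊T / δ⌋ : ℤ) : ℝ) ≤ T := by
    have := Int.floor_le (T / δ)
    rwa [le_div_iff₀ hδ, mul_comm] at this
  have h2 : T < δ * ((⌊T / δ⌋ : ℤ) : ℝ) + δ := by
    have := Int.lt_floor_add_one (T / δ)
    rw [div_lt_iff₀ hδ] at this
    linarith
  rw [abs_le]
  constructor <;> linarith

/-! ### The lattice mirror versus the Euclidean mirror -/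

/-- `‖ĝ‖₂ ≤ 2` for a cubic direction. [folklore] -/
theorem norm_siteVec_le_two_ps {g : Site 3} (hg : IsCubicDir g) : ‖siteVec g‖ ≤ 2 := by
  have h := norm_le_two_mul_of_abs_le (w := siteVec g) (b := 1) fun i => by
    rw [siteVec_apply]
    rcases hg.1 i with h | h | h <;> simp [h]
  linarith

/-- The integer factor `2 / (g·g)` of the lattice mirror is the real number `2/(g·g)`. [folklore] -/
theorem cast_two_div_zdot_ps {g : Site 3} (hg : IsCubicDir g) :
    ((2 / zdot g g : ℤ) : ℝ) = 2 / ((zdot g g : ℤ) : ℝ) := by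
  rcases hg.2 with h | h <;> rw [h] <;> norm_num

/-- `0 < g·g ≤ 2` in `ℝ`, so `2/(g·g) ≤ 2`. [folklore] -/
theorem two_div_zdot_le_two_ps {g : Site 3} (hg : IsCubicDir g) :
    0 ≤ 2 / ((zdot g g : ℤ) : ℝ) ∧ 2 / ((zdot g g : ℤ) : ℝ) ≤ 2 := by
  rcases hg.2 with h | h <;> rw [h] <;> norm_num

/-- The lattice mirror in real coordinates: `δ Θ y = δ y − (2/(g·g)) (δ g·y − δ c) ĝ`. [folklore] -/
theorem smul_siteVec_latticeMirror_ps {g : Site 3} (hg : IsCubicDir g) (c : ℤ) (δ : ℝ) (y : Site 3) :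
    (δ • siteVec (latticeMirror g c y) : EuclideanSpace ℝ (Fin 3)) =
      δ • siteVec y - (2 / ((zdot g g : ℤ) : ℝ) * (δ * zdot g y - δ * c)) • siteVec g := by
  have hcast := cast_two_div_zdot_ps hg
  ext i
  simp only [PiLp.smul_apply, PiLp.sub_apply, siteVec_apply, smul_eq_mul, latticeMirror_apply,
    Int.cast_sub, Int.cast_mul, hcast]
  ring

/-- **`‖δ Θ[q/δ] − reflectZ g T q‖ ≤ 22δ`** for the lattice mirror `Θ = latticeMirror g ⌊T/δ⌋` of a cubic
direction: both are `v ↦ v − (2/(g·g))(g·v − height) ĝ` with `v`, `g·v` and the height off by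
`2δ`, `4δ`, `δ`. [folklore] -/
theorem norm_lift_latticeMirror_sub_reflectZ_le_ps {g : Site 3} (hg : IsCubicDir g) {δ : ℝ} (hδ : 0 < δ)
    (T : ℝ) (q : EuclideanSpace ℝ (Fin 3)) :
    ‖(δ • siteVec (latticeMirror g ⌊T / δ⌋ (latticeApprox δ q)) : EuclideanSpace ℝ (Fin 3)) -
        reflectZ g T q‖ ≤ 22 * δ := by
  set y := latticeApprox δ q with hy
  set n : ℝ := ((zdot g g : ℤ) : ℝ) with hn
  obtain ⟨hn0, hn2⟩ := two_div_zdot_le_two_ps hg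
  have hA : ‖(δ • siteVec y : EuclideanSpace ℝ (Fin 3)) - q‖ ≤ 2 * δ := norm_lift_latticeApprox_sub_le_ps hδ q
  have hB : |δ * zdot g y - rdotZ g q| ≤ 4 * δ := abs_mul_zdot_latticeApprox_sub_le_ps hg hδ q
  have hC : |δ * ((⌊T / δ⌋ : ℤ) : ℝ) - T| ≤ δ := abs_mul_floor_sub_le_ps hδ T
  -- the difference of the two mirror images
  have hdiff : (δ • siteVec (latticeMirror g ⌊T / δ⌋ y) : EuclideanSpace ℝ (Fin 3)) - reflectZ g T q =
      ((δ • siteVec y : EuclideanSpace ℝ (Fin 3)) - q) -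
        (2 / n * ((δ * zdot g y - rdotZ g q) - (δ * ((⌊T / δ⌋ : ℤ) : ℝ) - T))) • siteVec g := by
    ext i
    simp only [smul_siteVec_latticeMirror_ps hg, reflectZ, PiLp.sub_apply, PiLp.smul_apply, siteVec_apply,
      smul_eq_mul, hn]
    ring
  rw [hdiff]
  refine (norm_sub_le _ _).trans ?_
  rw [norm_smul, Real.norm_eq_abs, abs_mul, abs_of_nonneg hn0]
  have hcoef : |(δ * zdot g y - rdotZ g q) - (δ * ((⌊T / δ⌋ : ℤ) : ℝ) - T)| ≤ 5 * δ :=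
    (abs_sub _ _).trans (by linarith)
  have hg2 := norm_siteVec_le_two_ps hg
  have : 2 / n * |(δ * zdot g y - rdotZ g q) - (δ * ((⌊T / δ⌋ : ℤ) : ℝ) - T)| * ‖siteVec g‖ ≤
      2 * (5 * δ) * 2 := by
    refine mul_le_mul (mul_le_mul hn2 hcoef (abs_nonneg _) (by norm_num)) hg2 (norm_nonneg _) ?_
    positivity
  linarith

/-- `‖δ Θ[q/δ] − reflectZ g T p‖ ≤ 22δ + dist q p` (the Euclidean mirror does not increase
distances). [folklore] -/
theorem norm_lift_latticeMirror_sub_reflectZ_le'_ps {g : Site 3} (hg : IsCubicDir g) {δ : ℝ}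
    (hδ : 0 < δ) (T : ℝ) (p q : EuclideanSpace ℝ (Fin 3)) :
    ‖(δ • siteVec (latticeMirror g ⌊T / δ⌋ (latticeApprox δ q)) : EuclideanSpace ℝ (Fin 3)) -
        reflectZ g T p‖ ≤ 22 * δ + dist q p := by
  have h := norm_sub_le
    ((δ • siteVec (latticeMirror g ⌊T / δ⌋ (latticeApprox δ q)) : EuclideanSpace ℝ (Fin 3)) - reflectZ g T q)
    (reflectZ g T p - reflectZ g T q)
  rw [sub_sub_sub_cancel_right] at h
  refine h.trans (add_le_add (norm_lift_latticeMirror_sub_reflectZ_le_ps hg hδ T q) ?_)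
  rw [← dist_eq_norm, dist_comm]
  exact dist_reflectZ_le_pa g T q p

/-! ### Configuration level -/

/-- **The lifted lattice doubled `A`-configuration is `O(δ)`-close to `doubledA g T x`.** For
configurations `s, t` (supplying the kept block and the mirrored block) and the reference `x`:
`dist (δ (Y_s ++ Θ Y_t)) (doubledA g T x) ≤ 22δ + max (dist s x) (dist t x)`, where
`Y_s j = [s (castAdd b j)/δ]`. [folklore] -/
theorem dist_liftA_doubledA_le_ps {g : Site 3} (hg : IsCubicDir g) {δ : ℝ} (hδ : 0 < δ) (T : ℝ)
    {a b : ℕ} (s t x : Fin (a + b) → EuclideanSpace ℝ (Fin 3)) :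
    dist (fun j => (δ • siteVec (Fin.append (fun j => latticeApprox δ (s (Fin.castAdd b j)))
        (latticeMirror g ⌊T / δ⌋ ∘ fun j => latticeApprox δ (t (Fin.castAdd b j))) j) :
          EuclideanSpace ℝ (Fin 3)))
      (doubledA g T x) ≤ 22 * δ + max (dist s x) (dist t x) := by
  refine (dist_pi_le_iff (by positivity)).2 fun j => ?_
  refine Fin.addCases (fun j => ?_) (fun j => ?_) j
  · rw [Fin.append_left, doubledA_left, dist_eq_norm]
    refine (norm_lift_latticeApprox_sub_le'_ps hδ _ _).trans ?_
    have := dist_le_pi_dist s x (Fin.castAdd b j)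
    have := le_max_left (dist s x) (dist t x)
    linarith
  · rw [Fin.append_right, doubledA_right, dist_eq_norm, Function.comp_apply]
    refine (norm_lift_latticeMirror_sub_reflectZ_le'_ps hg hδ T _ _).trans ?_
    have := dist_le_pi_dist t x (Fin.castAdd b j)
    have := le_max_right (dist s x) (dist t x)
    linarith

/-- **The lifted lattice doubled `B`-configuration is `22δ`-close to `doubledB g T x`.** [folklore] -/
theorem dist_liftB_doubledB_le_ps {g : Site 3} (hg : IsCubicDir g) {δ : ℝ} (hδ : 0 < δ) (T : ℝ)
    {a b : ℕ} (x : Fin (a + b) → EuclideanSpace ℝ (Fin 3)) :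
    dist (fun j => (δ • siteVec (Fin.append
        (latticeMirror g ⌊T / δ⌋ ∘ fun j => latticeApprox δ (x (Fin.natAdd a j)))
        (fun j => latticeApprox δ (x (Fin.natAdd a j))) j) : EuclideanSpace ℝ (Fin 3)))
      (doubledB g T x) ≤ 22 * δ := by
  refine (dist_pi_le_iff (by positivity)).2 fun j => ?_
  refine Fin.addCases (fun j => ?_) (fun j => ?_) j
  · rw [Fin.append_left, doubledB_left, dist_eq_norm, Function.comp_apply]
    exact norm_lift_latticeMirror_sub_reflectZ_le_ps hg hδ T _
  · rw [Fin.append_right, doubledB_right, dist_eq_norm]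
    linarith [norm_lift_latticeApprox_sub_le_ps hδ (x (Fin.natAdd a j))]

/-- Two lifts with the same mirrored block and kept blocks from `x`, `x'` are within
`4δ + dist x x'`. [folklore] -/
theorem dist_liftA_liftA_le_ps (g : Site 3) {δ : ℝ} (hδ : 0 < δ) (c : ℤ) {a b : ℕ}
    (x x' : Fin (a + b) → EuclideanSpace ℝ (Fin 3)) (Z : Fin a → Site 3) :
    dist (fun j => (δ • siteVec (Fin.append (fun j => latticeApprox δ (x (Fin.castAdd b j)))
        (latticeMirror g c ∘ Z) j) : EuclideanSpace ℝ (Fin 3)))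
      (fun j => (δ • siteVec (Fin.append (fun j => latticeApprox δ (x' (Fin.castAdd b j)))
        (latticeMirror g c ∘ Z) j) : EuclideanSpace ℝ (Fin 3))) ≤ 4 * δ + dist x x' := by
  refine (dist_pi_le_iff (by positivity)).2 fun j => ?_
  refine Fin.addCases (fun j => ?_) (fun j => ?_) j
  · simp only [Fin.append_left]
    rw [dist_eq_norm]
    have h1 := norm_lift_latticeApprox_sub_le_ps hδ (x (Fin.castAdd b j))
    have h2 := norm_lift_latticeApprox_sub_le_ps hδ (x' (Fin.castAdd b j))
    have h3 : dist (x (Fin.castAdd b j)) (x' (Fin.castAdd b j)) ≤ dist x x' := dist_le_pi_dist x x' _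
    rw [dist_eq_norm] at h3
    have h := norm_sub_le_norm_sub_add_norm_sub
      (δ • siteVec (latticeApprox δ (x (Fin.castAdd b j))) : EuclideanSpace ℝ (Fin 3))
      (x (Fin.castAdd b j)) (δ • siteVec (latticeApprox δ (x' (Fin.castAdd b j))))
    have h' := norm_sub_le_norm_sub_add_norm_sub (x (Fin.castAdd b j)) (x' (Fin.castAdd b j))
      (δ • siteVec (latticeApprox δ (x' (Fin.castAdd b j))) : EuclideanSpace ℝ (Fin 3))
    rw [norm_sub_rev (x' (Fin.castAdd b j))] at h'
    linarith
  · simp only [Fin.append_right]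
    rw [dist_self]
    positivity

/-- Two such lifts differ only at the kept index `castAdd a i₀` when `x`, `x'` differ only at
`castAdd b i₀`. [folklore] -/
theorem liftA_eq_of_ne_ps (g : Site 3) (δ : ℝ) (c : ℤ) {a b : ℕ} {i₀ : Fin a}
    {x x' : Fin (a + b) → EuclideanSpace ℝ (Fin 3)} (hdiff : ∀ l, l ≠ Fin.castAdd b i₀ → x' l = x l)
    (Z : Fin a → Site 3) :
    ∀ j, j ≠ Fin.castAdd a i₀ →
      (fun j => (δ • siteVec (Fin.append (fun j => latticeApprox δ (x' (Fin.castAdd b j)))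
        (latticeMirror g c ∘ Z) j) : EuclideanSpace ℝ (Fin 3))) j =
      (fun j => (δ • siteVec (Fin.append (fun j => latticeApprox δ (x (Fin.castAdd b j)))
        (latticeMirror g c ∘ Z) j) : EuclideanSpace ℝ (Fin 3))) j := by
  intro j hj
  refine Fin.addCases (fun j hj => ?_) (fun j _ => ?_) j hj
  · simp only [Fin.append_left]
    have hne : Fin.castAdd b j ≠ Fin.castAdd b i₀ := fun h => hj (by rw [Fin.castAdd_inj.1 h])
    rw [hdiff _ hne]
  · simp only [Fin.append_right]


/-- `natAdd a j ≠ castAdd b i` in `Fin (a + b)` (the blocks are disjoint). [folklore] -/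
theorem natAdd_ne_castAdd_ps {a b : ℕ} (j : Fin b) (i : Fin a) : Fin.natAdd a j ≠ Fin.castAdd b i := by
  intro h
  have h' := congrArg Fin.val h
  simp only [Fin.val_natAdd, Fin.val_castAdd] at h'
  omega

/-- **STUB `pedigreeStep` — THE CONTINUUM RECURSION STEP fed by the cluster move inequality (line
`only-interaction-breaks-moebius`, skeleton v4; registered 2026-08-16).** Along a mesh sequence
`u k → 0⁺`, on a compact `K` of non-coincident `(a+b)`-configurations all cut by the SAME cubic mirror
`{rdotZ g · = T}` with margin `κ` (cluster `A` = first `a` indices below, block `B` = last `b` indices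
above): if the pinned `(b+b)`-zoom is eventually bounded by `M` on the closed `η₀`-thickening of the
doubled `B`-configurations and the pinned `(a+a)`-zoom is single-variable asymptotically equicontinuous
at the index `castAdd a i₀` on the closed `η₀`-thickening of the doubled `A`-configurations, then the
pinned `(a+b)`-zoom is single-variable asymptotically equicontinuous at `castAdd b i₀` on `K`. The first
hypothesis is the statement of `clusterMoveIneq_cubic` (landed). Proof: at mesh `δ = u k` take the
lattice mirror `Θ = latticeMirror g ⌊T/δ⌋`; for `4δ ≤ κ` the lattice approximations of `x, x' ∈ K`
satisfy the side conditions of the cluster inequality (`zdot_latticeApprox_le_floor_ps`,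
`floor_le_zdot_latticeApprox_ps`), which multiplied by `ρ_pin(δ)^{2(a+b)}` reads
`(F x − F x')² ≤ [(F Z₁ − F Z₂) − (F Z₃ − F Z₄)] · F Z_B` for the lifts `Z₁ = δ(Y_A ++ ΘY_A)`,
`Z₂ = δ(Y'_A ++ ΘY_A)`, `Z₃ = δ(Y_A ++ ΘY'_A)`, `Z₄ = δ(Y'_A ++ ΘY'_A)`, `Z_B = δ(ΘY_B ++ Y_B)` (the middle
Gram entry is rewritten once by `Θ`-invariance, involutivity and a block swap, so that both pairs
differ only at the kept index `castAdd a i₀`); the lifts are within `22δ + dist x x'` of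
`doubledA g T x` / `doubledB g T x` (`dist_liftA_doubledA_le_ps`, `dist_liftB_doubledB_le_ps`), hence in
the `η₀`-thickenings, and the pairs are within `4δ + dist x x'` of each other (`dist_liftA_liftA_le_ps`),
so the bracket is `< 2ε₁` by the `SVEquicont` hypothesis and `|F Z_B| ≤ M`; with
`ε₁ = ε²/(2|M| + 2)` this gives `|F x − F x'| < ε`. [cite: FILS1978, §2]
[cite: DuminilCopinICM2022, §8.1 eq. (8.1)–(8.2)] -/
theorem pedigreeStep :
    (∀ (g : Site 3), IsCubicDir g → ∀ (c : ℤ),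
      (∀ (n : ℕ) (y : Fin n → Site 3), criticalCorr 3 n (latticeMirror g c ∘ y) = criticalCorr 3 n y) ∧
      ∀ (a b : ℕ) (i : Fin a) (yA yA' : Fin a → Site 3) (yB : Fin b → Site 3),
        (∀ j, j ≠ i → yA' j = yA j) → (∀ j, zdot g (yA j) ≤ c) → zdot g (yA' i) ≤ c →
        (∀ j, c ≤ zdot g (yB j)) →
        (criticalCorr 3 (a + b) (Fin.append yA yB) - criticalCorr 3 (a + b) (Fin.append yA' yB)) ^ 2 ≤
          (criticalCorr 3 (a + a) (Fin.append yA (latticeMirror g c ∘ yA))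
            - 2 * criticalCorr 3 (a + a) (Fin.append yA (latticeMirror g c ∘ yA'))
            + criticalCorr 3 (a + a) (Fin.append yA' (latticeMirror g c ∘ yA'))) *
          criticalCorr 3 (b + b) (Fin.append (latticeMirror g c ∘ yB) yB)) →
    ∀ u : ℕ → ℝ, Tendsto u atTop (𝓝[>] (0 : ℝ)) →
      ∀ (a b : ℕ) (i₀ : Fin a) (g : Site 3), IsCubicDir g → ∀ (T κ η₀ M : ℝ), 0 < κ → 0 < η₀ →
        ∀ K : Set (Fin (a + b) → EuclideanSpace ℝ (Fin 3)), IsCompact K → K ⊆ NonCoincident 3 (a + b) →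
          (∀ x ∈ K, (∀ j : Fin a, rdotZ g (x (Fin.castAdd b j)) + κ ≤ T) ∧
            (∀ j : Fin b, T + κ ≤ rdotZ g (x (Fin.natAdd a j)))) →
          (∀ᶠ k in atTop, ∀ z ∈ Metric.cthickening η₀ (doubledB g T '' K),
            |rescaledCorrelator (criticalCorr 3) rhoPin (b + b) (u k) z| ≤ M) →
          SVEquicont u (a + a) (Metric.cthickening η₀ (doubledA g T '' K)) (Fin.castAdd a i₀) →
          SVEquicont u (a + b) K (Fin.castAdd b i₀) := by
  intro hCM u hu a b i₀ g hg T κ η₀ M hκ hη₀ K _hK _hKs hcut hLB hSV ε hε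
  have hupos : ∀ᶠ k in atTop, 0 < u k := (tendsto_nhdsWithin_iff.1 hu).2
  have hu0 : Tendsto u atTop (𝓝 0) := (tendsto_nhdsWithin_iff.1 hu).1
  -- the modulus of the `(a+a)`-zoom for `ε₁ = ε²/(2|M|+2)`
  set ε₁ : ℝ := ε ^ 2 / (2 * |M| + 2) with hε₁
  have hε₁pos : 0 < ε₁ := by positivity
  obtain ⟨η₁, hη₁, hE₁⟩ := hSV ε₁ hε₁pos
  -- small meshes
  have hsmall : ∀ᶠ k in atTop, u k < min (κ / 4) (min (η₁ / 8) (η₀ / 44)) :=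
    hu0.eventually (gt_mem_nhds (by positivity))
  refine ⟨min (η₁ / 2) (η₀ / 2), by positivity, ?_⟩
  filter_upwards [hE₁, hLB, hupos, hsmall] with k hE₁k hLBk hpos hsm x hx x' hx' hdiff hdist
  -- the mesh and its smallness
  set δ : ℝ := u k with hδ
  have hsm₁ : δ < κ / 4 := lt_of_lt_of_le hsm (min_le_left _ _)
  have hsm₂ : δ < η₁ / 8 := lt_of_lt_of_le hsm ((min_le_right _ _).trans (min_le_left _ _))
  have hsm₃ : δ < η₀ / 44 := lt_of_lt_of_le hsm ((min_le_right _ _).trans (min_le_right _ _))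
  have hδκ : 4 * δ ≤ κ := by linarith
  have hdist₁ : dist x x' < η₁ / 2 := lt_of_lt_of_le hdist (min_le_left _ _)
  have hdist₀ : dist x x' < η₀ / 2 := lt_of_lt_of_le hdist (min_le_right _ _)
  have hdist' : dist x' x < η₀ / 2 := by rwa [dist_comm]
  -- lattice data at mesh `δ`
  set c : ℤ := ⌊T / δ⌋ with hc
  set yA : Fin a → Site 3 := fun j => latticeApprox δ (x (Fin.castAdd b j)) with hyA
  set yA' : Fin a → Site 3 := fun j => latticeApprox δ (x' (Fin.castAdd b j)) with hyA'
  set yB : Fin b → Site 3 := fun j => latticeApprox δ (x (Fin.natAdd a j)) with hyB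
  have hy : (fun l => latticeApprox δ (x l)) = Fin.append yA yB :=
    (Fin.append_castAdd_natAdd (f := fun l => latticeApprox δ (x l))).symm
  have hy' : (fun l => latticeApprox δ (x' l)) = Fin.append yA' yB := by
    rw [← Fin.append_castAdd_natAdd (f := fun l => latticeApprox δ (x' l))]
    congr 1
    funext j
    show latticeApprox δ (x' (Fin.natAdd a j)) = latticeApprox δ (x (Fin.natAdd a j))
    rw [hdiff _ (natAdd_ne_castAdd_ps j i₀)]
  -- lattice side conditions of the cluster move inequality
  have hsA : ∀ j, zdot g (yA j) ≤ c := fun j =>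
    zdot_latticeApprox_le_floor_ps hg hpos hδκ ((hcut x hx).1 j)
  have hsA' : zdot g (yA' i₀) ≤ c := zdot_latticeApprox_le_floor_ps hg hpos hδκ ((hcut x' hx').1 i₀)
  have hsB : ∀ j, c ≤ zdot g (yB j) := fun j =>
    floor_le_zdot_latticeApprox_ps hg hpos hδκ ((hcut x hx).2 j)
  have hdiffA : ∀ j, j ≠ i₀ → yA' j = yA j := fun j hj => by
    show latticeApprox δ (x' (Fin.castAdd b j)) = latticeApprox δ (x (Fin.castAdd b j))
    rw [hdiff _ fun h => hj (Fin.castAdd_inj.1 h)]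
  obtain ⟨hinvar, hineq⟩ := hCM g hg c
  have hCI := hineq a b i₀ yA yA' yB hdiffA hsA hsA' hsB
  -- the middle Gram entry, rewritten: `G(Y_A ++ ΘY'_A) = G(Y'_A ++ ΘY_A)`
  have hmid : criticalCorr 3 (a + a) (Fin.append yA (latticeMirror g c ∘ yA')) =
      criticalCorr 3 (a + a) (Fin.append yA' (latticeMirror g c ∘ yA)) := by
    have h1 := hinvar (a + a) (Fin.append yA (latticeMirror g c ∘ yA'))
    rw [comp_append] at h1
    have hΘΘ : latticeMirror g c ∘ (latticeMirror g c ∘ yA') = yA' :=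
      funext fun j => latticeMirror_latticeMirror_cm hg c (yA' j)
    rw [hΘΘ] at h1
    rw [← h1, criticalCorr_append_comm]
  -- the lifts
  set Z₁ : Fin (a + a) → EuclideanSpace ℝ (Fin 3) :=
    fun j => δ • siteVec (Fin.append yA (latticeMirror g c ∘ yA) j) with hZ₁
  set Z₂ : Fin (a + a) → EuclideanSpace ℝ (Fin 3) :=
    fun j => δ • siteVec (Fin.append yA' (latticeMirror g c ∘ yA) j) with hZ₂
  set Z₃ : Fin (a + a) → EuclideanSpace ℝ (Fin 3) :=
    fun j => δ • siteVec (Fin.append yA (latticeMirror g c ∘ yA') j) with hZ₃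
  set Z₄ : Fin (a + a) → EuclideanSpace ℝ (Fin 3) :=
    fun j => δ • siteVec (Fin.append yA' (latticeMirror g c ∘ yA') j) with hZ₄
  set ZB : Fin (b + b) → EuclideanSpace ℝ (Fin 3) :=
    fun j => δ • siteVec (Fin.append (latticeMirror g c ∘ yB) yB j) with hZB
  -- the zooms at the lifts and at `x`, `x'`
  have hFx : rescaledCorrelator (criticalCorr 3) rhoPin (a + b) δ x =
      rhoPin δ ^ (a + b) * criticalCorr 3 (a + b) (Fin.append yA yB) := by
    rw [rescaledCorrelator_apply, hy]
  have hFx' : rescaledCorrelator (criticalCorr 3) rhoPin (a + b) δ x' =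
      rhoPin δ ^ (a + b) * criticalCorr 3 (a + b) (Fin.append yA' yB) := by
    rw [rescaledCorrelator_apply, hy']
  have hF₁ : rescaledCorrelator (criticalCorr 3) rhoPin (a + a) δ Z₁ =
      rhoPin δ ^ (a + a) * criticalCorr 3 (a + a) (Fin.append yA (latticeMirror g c ∘ yA)) :=
    rescaledCorrelator_lift_ps hpos _
  have hF₂ : rescaledCorrelator (criticalCorr 3) rhoPin (a + a) δ Z₂ =
      rhoPin δ ^ (a + a) * criticalCorr 3 (a + a) (Fin.append yA (latticeMirror g c ∘ yA')) := by
    rw [hmid]; exact rescaledCorrelator_lift_ps hpos _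
  have hF₃ : rescaledCorrelator (criticalCorr 3) rhoPin (a + a) δ Z₃ =
      rhoPin δ ^ (a + a) * criticalCorr 3 (a + a) (Fin.append yA (latticeMirror g c ∘ yA')) :=
    rescaledCorrelator_lift_ps hpos _
  have hF₄ : rescaledCorrelator (criticalCorr 3) rhoPin (a + a) δ Z₄ =
      rhoPin δ ^ (a + a) * criticalCorr 3 (a + a) (Fin.append yA' (latticeMirror g c ∘ yA')) :=
    rescaledCorrelator_lift_ps hpos _
  have hFB : rescaledCorrelator (criticalCorr 3) rhoPin (b + b) δ ZB =
      rhoPin δ ^ (b + b) * criticalCorr 3 (b + b) (Fin.append (latticeMirror g c ∘ yB) yB) :=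
    rescaledCorrelator_lift_ps hpos _
  -- the cluster inequality at scale
  have key : (rescaledCorrelator (criticalCorr 3) rhoPin (a + b) δ x -
        rescaledCorrelator (criticalCorr 3) rhoPin (a + b) δ x') ^ 2 ≤
      ((rescaledCorrelator (criticalCorr 3) rhoPin (a + a) δ Z₁ -
          rescaledCorrelator (criticalCorr 3) rhoPin (a + a) δ Z₂) -
        (rescaledCorrelator (criticalCorr 3) rhoPin (a + a) δ Z₃ -
          rescaledCorrelator (criticalCorr 3) rhoPin (a + a) δ Z₄)) *
      rescaledCorrelator (criticalCorr 3) rhoPin (b + b) δ ZB := by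
    rw [hFx, hFx', hF₁, hF₂, hF₃, hF₄, hFB]
    have hρ : 0 ≤ rhoPin δ ^ (a + b) * rhoPin δ ^ (a + b) := mul_self_nonneg _
    calc (rhoPin δ ^ (a + b) * criticalCorr 3 (a + b) (Fin.append yA yB) -
          rhoPin δ ^ (a + b) * criticalCorr 3 (a + b) (Fin.append yA' yB)) ^ 2
        = rhoPin δ ^ (a + b) * rhoPin δ ^ (a + b) *
          (criticalCorr 3 (a + b) (Fin.append yA yB) - criticalCorr 3 (a + b) (Fin.append yA' yB)) ^ 2 := by
          ring
      _ ≤ rhoPin δ ^ (a + b) * rhoPin δ ^ (a + b) *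
          ((criticalCorr 3 (a + a) (Fin.append yA (latticeMirror g c ∘ yA))
            - 2 * criticalCorr 3 (a + a) (Fin.append yA (latticeMirror g c ∘ yA'))
            + criticalCorr 3 (a + a) (Fin.append yA' (latticeMirror g c ∘ yA'))) *
          criticalCorr 3 (b + b) (Fin.append (latticeMirror g c ∘ yB) yB)) :=
          mul_le_mul_of_nonneg_left hCI hρ
      _ = _ := by ring
  -- membership of the lifts in the thickenings
  have hxK : doubledA g T x ∈ doubledA g T '' K := mem_image_of_mem _ hx
  have hxKB : doubledB g T x ∈ doubledB g T '' K := mem_image_of_mem _ hx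
  have hm₁ : Z₁ ∈ Metric.cthickening η₀ (doubledA g T '' K) := by
    refine Metric.mem_cthickening_of_dist_le _ _ _ _ hxK ?_
    refine (dist_liftA_doubledA_le_ps hg hpos T x x x).trans ?_
    rw [dist_self, max_self]; linarith
  have hm₂ : Z₂ ∈ Metric.cthickening η₀ (doubledA g T '' K) := by
    refine Metric.mem_cthickening_of_dist_le _ _ _ _ hxK ?_
    refine (dist_liftA_doubledA_le_ps hg hpos T x' x x).trans ?_
    rw [dist_self, max_eq_left dist_nonneg]; linarith
  have hm₃ : Z₃ ∈ Metric.cthickening η₀ (doubledA g T '' K) := by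
    refine Metric.mem_cthickening_of_dist_le _ _ _ _ hxK ?_
    refine (dist_liftA_doubledA_le_ps hg hpos T x x' x).trans ?_
    rw [dist_self, max_eq_right dist_nonneg]; linarith
  have hm₄ : Z₄ ∈ Metric.cthickening η₀ (doubledA g T '' K) := by
    refine Metric.mem_cthickening_of_dist_le _ _ _ _ hxK ?_
    refine (dist_liftA_doubledA_le_ps hg hpos T x' x' x).trans ?_
    rw [max_self]; linarith
  have hmB : ZB ∈ Metric.cthickening η₀ (doubledB g T '' K) := by
    refine Metric.mem_cthickening_of_dist_le _ _ _ _ hxKB ?_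
    refine (dist_liftB_doubledB_le_ps hg hpos T x).trans ?_
    linarith
  -- the two single moves of the kept index and the bounded block
  have hBr₁ : |rescaledCorrelator (criticalCorr 3) rhoPin (a + a) δ Z₁ -
      rescaledCorrelator (criticalCorr 3) rhoPin (a + a) δ Z₂| < ε₁ := by
    refine hE₁k Z₁ hm₁ Z₂ hm₂ (liftA_eq_of_ne_ps g δ c hdiff yA) ?_
    refine lt_of_le_of_lt (dist_liftA_liftA_le_ps g hpos c x x' yA) ?_
    linarith
  have hBr₂ : |rescaledCorrelator (criticalCorr 3) rhoPin (a + a) δ Z₃ -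
      rescaledCorrelator (criticalCorr 3) rhoPin (a + a) δ Z₄| < ε₁ := by
    refine hE₁k Z₃ hm₃ Z₄ hm₄ (liftA_eq_of_ne_ps g δ c hdiff yA') ?_
    refine lt_of_le_of_lt (dist_liftA_liftA_le_ps g hpos c x x' yA') ?_
    linarith
  have hS : |rescaledCorrelator (criticalCorr 3) rhoPin (b + b) δ ZB| ≤ M := hLBk ZB hmB
  -- conclusion
  set P := (rescaledCorrelator (criticalCorr 3) rhoPin (a + a) δ Z₁ -
      rescaledCorrelator (criticalCorr 3) rhoPin (a + a) δ Z₂) -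
    (rescaledCorrelator (criticalCorr 3) rhoPin (a + a) δ Z₃ -
      rescaledCorrelator (criticalCorr 3) rhoPin (a + a) δ Z₄) with hP
  set Q := rescaledCorrelator (criticalCorr 3) rhoPin (b + b) δ ZB with hQ
  have hPabs : |P| < 2 * ε₁ := (abs_sub _ _).trans_lt (by linarith)
  have hPQ : P * Q ≤ 2 * ε₁ * M := by
    refine (le_abs_self _).trans ?_
    rw [abs_mul]
    refine (mul_le_mul_of_nonneg_right hPabs.le (abs_nonneg _)).trans ?_
    exact mul_le_mul_of_nonneg_left hS (by positivity)
  have hMε : 2 * ε₁ * M < ε ^ 2 := by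
    have hM2 : 0 < 2 * |M| + 2 := by positivity
    have hle : 2 * ε₁ * M ≤ 2 * ε₁ * |M| := mul_le_mul_of_nonneg_left (le_abs_self M) (by positivity)
    have heq : 2 * ε₁ * |M| = ε ^ 2 * (2 * |M|) / (2 * |M| + 2) := by rw [hε₁]; ring
    have hlt : ε ^ 2 * (2 * |M|) / (2 * |M| + 2) < ε ^ 2 := by
      rw [div_lt_iff₀ hM2]
      nlinarith [pow_pos hε 2]
    linarith
  have hsq : (rescaledCorrelator (criticalCorr 3) rhoPin (a + b) δ x -
      rescaledCorrelator (criticalCorr 3) rhoPin (a + b) δ x') ^ 2 < ε ^ 2 :=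
    lt_of_le_of_lt (key.trans hPQ) hMε
  exact abs_lt_of_sq_lt_sq hsq hε.le


/-- **Single-variable asymptotic equicontinuity of the pinned zoom at EVERY configuration (glue, kernel-checked;
no stub in its cone).** Under the two-point law, along every mesh sequence, on every compact `K ⊆ NonCoincident 3 n`
and for every index `i`: `SVEquicont u n K i`. Proof: by locality (`svEquicont_of_locally_pa`) it suffices to treat the
piece `closedBall x (μ/4) ∩ K` around each `x ∈ K`, where `μ > 0` is the margin of a mirror pedigree of `x` of some depth
`d` (`pedigree_cover ∘ covering_all`); by `pedigree_mono` every configuration of the piece has a depth-`≤ d` pedigree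
with margin `μ/2`, and `pedigree_assembly` (fed with `pedigreeStep`, `pedigree_mono`, `svEquicont_transport`,
`doubled_thickening`) concludes. [folklore] -/
theorem svEquicont_all {Δ c : ℝ} (hc : 0 < c)
    (hG : Tendsto (fun y : Site 3 => criticalTwoPoint 3 y * Real.sqrt (∑ i, ((y i : ℝ)) ^ 2) ^ (2 * Δ))
      cofinite (𝓝 c))
    {u : ℕ → ℝ} (hu : Tendsto u atTop (𝓝[>] (0 : ℝ))) (n : ℕ)
    (K : Set (Fin n → EuclideanSpace ℝ (Fin 3))) (hK : IsCompact K) (hKs : K ⊆ NonCoincident 3 n) (i : Fin n) :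
    SVEquicont u n K i := by
  refine svEquicont_of_locally_pa hK fun x hx => ?_
  obtain ⟨μ, hμ, d, hped⟩ := pedigree_cover covering_all n x (hKs hx) i
  refine ⟨μ / 4, by positivity, ?_⟩
  refine pedigree_assembly (pedigreeStep clusterMoveIneq_cubic) pedigree_mono svEquicont_transport doubled_thickening Δ c hc hG u hu d
    (μ / 2) (by positivity) n i _ (hK.inter_left Metric.isClosed_closedBall) (fun y hy => hKs hy.2) fun y hy => ?_
  have hdist : dist x y ≤ μ / 4 := by
    rw [dist_comm]
    exact Metric.mem_closedBall.1 hy.1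
  have h := pedigree_mono μ (μ / 4) d n x y i hped hdist
  have hμ2 : μ - 2 * (μ / 4) = μ / 2 := by ring
  rwa [hμ2] at h

/-- **STUB 1″d — the former RESIDUE `stub_equicontinuity_inner`, now a THEOREM (no stub in its cone)** (registered
signature kept verbatim: single-variable asymptotic equicontinuity at the configurations whose moving point is NOT
separated from the others by a coordinate slab of width `κ`, for some `κ > 0` of the prover's choice — here `κ = 1`,
and the non-separation hypothesis is simply not used, `svEquicont_all` serving every configuration).
[cite: DuminilCopinICM2022, §8.4 p. 29] [cite: AizenmanDuminilCopinAnnals2021, arXiv:1912.07973 Remark 5.10 and Def. 5.11] -/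
theorem stub_equicontinuity_inner :
    ∀ (Δ c : ℝ), 0 < c →
      Tendsto (fun y : Site 3 => criticalTwoPoint 3 y * Real.sqrt (∑ i, ((y i : ℝ)) ^ 2) ^ (2 * Δ))
        cofinite (𝓝 c) →
      ∀ u : ℕ → ℝ, Tendsto u atTop (𝓝[>] (0 : ℝ)) →
        ∀ (N : ℕ) (K : Set (Fin N → EuclideanSpace ℝ (Fin 3))), IsCompact K → K ⊆ NonCoincident 3 N →
          ∀ i : Fin N, ∃ κ > 0, ∀ ε > 0, ∃ η > 0, ∀ᶠ k in atTop, ∀ x ∈ K, ∀ x' ∈ K,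
            (∀ j, j ≠ i → x' j = x j) →
            ¬ (∃ τ : Fin 3, (∀ j, j ≠ i → x i τ + κ ≤ x j τ) ∨ (∀ j, j ≠ i → x j τ + κ ≤ x i τ)) →
            dist x x' < η →
              |rescaledCorrelator (criticalCorr 3) rhoPin N (u k) x -
                rescaledCorrelator (criticalCorr 3) rhoPin N (u k) x'| < ε := by
  intro Δ c hc hG u hu N K hK hKs i
  refine ⟨1, one_pos, fun ε hε => ?_⟩
  obtain ⟨η, hη, h⟩ := svEquicont_all hc hG hu N K hK hKs i ε hε
  exact ⟨η, hη, h.mono fun k hk x hx x' hx' hdiff _ hdist => hk x hx x' hx' hdiff hdist⟩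

/-- **Single-variable asymptotic equicontinuity of the pinned zoom at every configuration** (= `svEquicont_all`,
unfolded). [folklore] -/
theorem pinnedZoom_singleVariable_equicontinuity {Δ c : ℝ} (hc : 0 < c)
    (hG : Tendsto (fun y : Site 3 => criticalTwoPoint 3 y * Real.sqrt (∑ i, ((y i : ℝ)) ^ 2) ^ (2 * Δ))
      cofinite (𝓝 c))
    {u : ℕ → ℝ} (hu : Tendsto u atTop (𝓝[>] (0 : ℝ))) (N : ℕ)
    (K : Set (Fin N → EuclideanSpace ℝ (Fin 3))) (hK : IsCompact K) (hKs : K ⊆ NonCoincident 3 N)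
    (i : Fin N) :
    ∀ ε > 0, ∃ η > 0, ∀ᶠ k in atTop, ∀ x ∈ K, ∀ x' ∈ K,
      (∀ j, j ≠ i → x' j = x j) → dist x x' < η →
        |rescaledCorrelator (criticalCorr 3) rhoPin N (u k) x -
          rescaledCorrelator (criticalCorr 3) rhoPin N (u k) x'| < ε :=
  svEquicont_all hc hG hu N K hK hKs i

/-- **The former STUB 1″ — ASYMPTOTIC EQUICONTINUITY of the pinned `2m`-point zoom off the diagonals,
`m ≥ 2`, now PROVED modulo `stub_equicontinuity_inner` (and the provable toolkit pieces
`moveIneq_latticeRP`, `sepMove_equicontinuity`, `telescoping_equicontinuity`).** Under the two-point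
law (item 0634's data as hypotheses), along every mesh sequence `u k → 0⁺` and on every compact set `K`
of non-coincident `2m`-point configurations, for every `ε > 0` there is `η > 0` such that eventually in
`k`, `|F(x) − F(y)| < ε` whenever `x, y ∈ K`, `dist x y < η`. Implied by the crux (refuter, landed
`Negative/OnlyInteractionTightness.lean`, `Negative/AsympEquicontinuity.lean`).
[cite: DuminilCopinICM2022, §8.4 p. 29] -/
theorem stub_equicontinuity_ge_four :
    ∀ (Δ c : ℝ), 0 < c →
      Tendsto (fun y : Site 3 => criticalTwoPoint 3 y * Real.sqrt (∑ i, ((y i : ℝ)) ^ 2) ^ (2 * Δ))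
        cofinite (𝓝 c) →
      ∀ u : ℕ → ℝ, Tendsto u atTop (𝓝[>] (0 : ℝ)) →
        ∀ m : ℕ, 2 ≤ m →
          ∀ (K : Set (Fin (2 * m) → EuclideanSpace ℝ (Fin 3))), IsCompact K → K ⊆ NonCoincident 3 (2 * m) →
            ∀ ε > 0, ∃ η > 0, ∀ᶠ k in atTop, ∀ x ∈ K, ∀ y ∈ K, dist x y < η →
              |rescaledCorrelator (criticalCorr 3) rhoPin (2 * m) (u k) x -
                rescaledCorrelator (criticalCorr 3) rhoPin (2 * m) (u k) y| < ε := by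
  intro Δ c hc hG u hu m _hm K hK hKs
  exact telescoping_equicontinuity (2 * m)
    (fun k x => rescaledCorrelator (criticalCorr 3) rhoPin (2 * m) (u k) x) (NonCoincident 3 (2 * m))
    (isOpen_nonCoincident 3 (2 * m))
    (fun K' hK' hK's i => pinnedZoom_singleVariable_equicontinuity hc hG hu (2 * m) K' hK' hK's i) K hK hKs

/-- **Asymptotic equicontinuity of the pinned zoom at ALL orders, modulo STUB 1″**: order `0` is the
constant `1`, odd orders vanish identically (`criticalCorr_eq_zero_of_odd`, `m*(β_c) = 0`), order `2` is
the landed `pinnedZoomEquicontinuous_two`, even orders `≥ 4` are `stub_equicontinuity_ge_four`. [folklore] -/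
theorem pinnedZoom_equicontinuity :
    ∀ (Δ c : ℝ), 0 < c →
      Tendsto (fun y : Site 3 => criticalTwoPoint 3 y * Real.sqrt (∑ i, ((y i : ℝ)) ^ 2) ^ (2 * Δ))
        cofinite (𝓝 c) →
      ∀ u : ℕ → ℝ, Tendsto u atTop (𝓝[>] (0 : ℝ)) →
        ∀ n (K : Set (Fin n → EuclideanSpace ℝ (Fin 3))), IsCompact K → K ⊆ NonCoincident 3 n →
          ∀ ε > 0, ∃ η > 0, ∀ᶠ k in atTop, ∀ x ∈ K, ∀ y ∈ K, dist x y < η →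
            |rescaledCorrelator (criticalCorr 3) rhoPin n (u k) x -
              rescaledCorrelator (criticalCorr 3) rhoPin n (u k) y| < ε := by
  intro Δ c hc hG u hu n K hK hKs ε hε
  rcases Nat.even_or_odd n with ⟨m, hm⟩ | hodd
  · obtain rfl : n = 2 * m := by omega
    rcases Nat.lt_or_ge m 2 with hm2 | hm2
    · interval_cases m
      · -- order 0: the configuration space is a single point
        refine ⟨1, one_pos, Filter.Eventually.of_forall fun k x _ y _ _ => ?_⟩
        have hxy : x = y := funext fun i => absurd i.2 (by omega)
        subst hxy
        simpa using hε
      · exact pinnedZoomEquicontinuous_two Δ c hc hG u hu K hK hKs ε hε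
    · exact stub_equicontinuity_ge_four Δ c hc hG u hu m hm2 K hK hKs ε hε
  · -- odd orders vanish identically on the lattice
    refine ⟨1, one_pos, Filter.Eventually.of_forall fun k x _ y _ _ => ?_⟩
    rw [rescaledCorrelator_apply, rescaledCorrelator_apply, criticalCorr_eq_zero_of_odd (d := 3) le_rfl hodd,
      criticalCorr_eq_zero_of_odd (d := 3) le_rfl hodd]
    simpa using hε

/-- **COMPACTNESS of the pinned zoom with REGULAR cluster points — the former STUB 1, now PROVED modulo
`stub_equicontinuity_ge_four`** from the landed sub-goals `compactnessSchema` (abstract Arzelà–Ascoli / Cantor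
diagonal, p72765), `pinnedZoomLocallyBounded` (Gaussian pairing bound + two-point doubling under 0634,
p73886) and `pinnedZoomTranslationInvariant` (equicontinuity + lattice translation invariance, p74332):
under the two-point law every mesh sequence `u k → 0⁺` has a subsequence along which, for every `n` at
once, the pinned rescaled critical correlators converge locally uniformly off the diagonals to a
normalised, continuous-off-diagonals, translation-invariant family. [folklore] -/
theorem pinnedZoom_compactness {Δ c : ℝ} (hc : 0 < c)
    (hG : Tendsto (fun y : Site 3 => criticalTwoPoint 3 y * Real.sqrt (∑ i, ((y i : ℝ)) ^ 2) ^ (2 * Δ))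
      cofinite (𝓝 c)) :
    ∀ u : ℕ → ℝ, Tendsto u atTop (𝓝[>] (0 : ℝ)) →
      ∃ (φ : ℕ → ℕ) (S : CorrFamily 3), StrictMono φ ∧ IsRegular S ∧
        ∀ n, TendstoLocallyUniformlyOn
          (fun k => rescaledCorrelator (criticalCorr 3) rhoPin n (u (φ k))) (S n) atTop
          (NonCoincident 3 n) := by
  intro u hu
  obtain ⟨φ, S, hφ, hnorm, hcont, hconv⟩ := compactnessSchema
    (fun n k x => rescaledCorrelator (criticalCorr 3) rhoPin n (u k) x)
    (fun n K hK hKs => pinnedZoomLocallyBounded Δ c hc hG u hu n K hK hKs)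
    (fun n K hK hKs => pinnedZoom_equicontinuity Δ c hc hG u hu n K hK hKs)
  have hu' : Tendsto (u ∘ φ) atTop (𝓝[>] (0 : ℝ)) := hu.comp hφ.tendsto_atTop
  refine ⟨φ, S, hφ, ⟨hnorm, hcont, ?_⟩, hconv⟩
  exact pinnedZoomTranslationInvariant (u ∘ φ) hu'
    (fun n K hK hKs => pinnedZoom_equicontinuity Δ c hc hG (u ∘ φ) hu' n K hK hKs) S hnorm hconv


/-! ### Low orders of regular cluster points are free (orders `0`, odd, `2`) -/

/-- `⟨1⟩_{β_c} = 1`: the critical correlator of the empty configuration. [folklore] -/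
theorem criticalCorr_orderZero_eq_one (y : Fin 0 → Site 3) : criticalCorr 3 0 y = 1 := by
  have hy : spinMonomial y = fun _ => (1:ℝ) := by
    funext s; simp [spinMonomial]
  show plusExpect 3 (criticalBeta 3) 0 (spinMonomial y) = 1
  rw [hy]
  show limUnder atTop
      (fun L : ℕ => isingExpect (zdGraph 3) (box 3 L) (criticalBeta 3) 0 .plus (fun _ => (1:ℝ))) = 1
  simp_rw [isingExpect_const]
  exact tendsto_const_nhds.limUnder_eq

/-- Order `0` of a cluster point is `1`. [folklore] -/
theorem IsClusterPoint.orderZero_eq_one {S : CorrFamily 3} (hS : IsClusterPoint S)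
    (x : Fin 0 → EuclideanSpace ℝ (Fin 3)) : S 0 x = 1 := by
  obtain ⟨u, -, hconv⟩ := hS
  have hx : x ∈ NonCoincident 3 0 := by
    rw [mem_nonCoincident]; intro i; exact Fin.elim0 i
  have h := (hconv 0).tendsto_at hx
  have h1 : Tendsto (fun k => rescaledCorrelator (criticalCorr 3) rhoPin 0 (u k) x) atTop (𝓝 1) := by
    refine tendsto_const_nhds.congr fun k => ?_
    rw [rescaledCorrelator_apply, pow_zero, one_mul, criticalCorr_orderZero_eq_one]
  exact tendsto_nhds_unique h h1

/-- Odd orders of a cluster point vanish on non-coincident configurations (`m*(β_c) = 0` on `ℤ³`: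
`criticalCorr_eq_zero_of_odd`). [cite: AizenmanDuminilCopinSidoraviciusCMP2015, Thm. 1.2] -/
theorem IsClusterPoint.eq_zero_of_odd {S : CorrFamily 3} (hS : IsClusterPoint S) {n : ℕ} (hn : Odd n)
    {x : Fin n → EuclideanSpace ℝ (Fin 3)} (hx : x ∈ NonCoincident 3 n) : S n x = 0 := by
  obtain ⟨u, -, hconv⟩ := hS
  have h := (hconv n).tendsto_at hx
  have h0 : Tendsto (fun k => rescaledCorrelator (criticalCorr 3) rhoPin n (u k) x) atTop (𝓝 0) := by
    refine tendsto_const_nhds.congr fun k => ?_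
    rw [rescaledCorrelator_apply, criticalCorr_eq_zero_of_odd (d := 3) le_rfl hn, mul_zero]
  exact tendsto_nhds_unique h h0

/-- A REGULAR cluster point vanishes identically at odd orders (on `NonCoincident` by the lattice, off
it by normalisation). [folklore] -/
theorem eq_zero_of_odd_of_regular {S : CorrFamily 3} (hS : IsClusterPoint S) (hreg : IsRegular S)
    {n : ℕ} (hn : Odd n) (x : Fin n → EuclideanSpace ℝ (Fin 3)) : S n x = 0 := by
  by_cases hx : x ∈ NonCoincident 3 n
  · exact hS.eq_zero_of_odd hn hx
  · exact hreg.1 n x hx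

/-! ### The open covariance / uniqueness stubs, cut down to their true locus: even orders `≥ 4` -/



/-- **Inversion covariance of a regular cluster point from its even orders `≥ 4` (the former STUB 5 modulo the residue
5′, here the hypothesis `h5`)**: orders `0` (both sides `1`), odd (both sides `0`), `2` (the pure power transforms with the
gauge `‖p‖^{2Δ}‖q‖^{2Δ}`, `WickPowerMoebius.powerKernel_inversion`) and coincident configurations
(both sides `0` by normalisation, `ι` being injective) are free. [folklore] -/
theorem isInversionCovariant_of_ge_four {Δ : ℝ} {S : CorrFamily 3} (hS : IsClusterPoint S)
    (hreg : IsRegular S) (h2 : ∀ x ∈ NonCoincident 3 2, S 2 x = ‖x 0 - x 1‖ ^ (-(2 * Δ)))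
    (h5 : ∀ m : ℕ, 2 ≤ m → ∀ x : Fin (2 * m) → EuclideanSpace ℝ (Fin 3), x ∈ NonCoincident 3 (2 * m) →
      (∀ i, x i ≠ 0) →
      S (2 * m) (fun i => EuclideanGeometry.inversion 0 1 (x i)) = (∏ i, ‖x i‖ ^ (2 * Δ)) * S (2 * m) x) :
    IsInversionCovariant Δ S := by
  have hι : Function.Injective (EuclideanGeometry.inversion (0 : EuclideanSpace ℝ (Fin 3)) 1) :=
    EuclideanGeometry.inversion_injective _ one_ne_zero
  intro n x hx0
  rcases Nat.even_or_odd n with ⟨m, hm⟩ | hodd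
  · obtain rfl : n = 2 * m := by omega
    by_cases hx : x ∈ NonCoincident 3 (2 * m)
    · rcases Nat.lt_or_ge m 2 with hm2 | hm2
      · interval_cases m
        · rw [hS.orderZero_eq_one, hS.orderZero_eq_one]
          simp
        · have hιx : (fun i => EuclideanGeometry.inversion 0 1 (x i)) ∈ NonCoincident 3 (2 * 1) :=
            (WickPowerMoebius.comp_mem_nonCoincident_iff hι x).2 hx
          rw [h2 _ hιx, h2 _ hx]
          have hk := WickPowerMoebius.powerKernel_inversion Δ (hx0 0) (hx0 1)
          simp only [powerKernel] at hk
          rw [hk, Fin.prod_univ_two]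
      · exact h5 m hm2 x hx hx0
    · have hιx : (fun i => EuclideanGeometry.inversion 0 1 (x i)) ∉ NonCoincident 3 (2 * m) :=
        fun h => hx ((WickPowerMoebius.comp_mem_nonCoincident_iff hι x).1 h)
      rw [hreg.1 _ _ hιx, hreg.1 _ _ hx, mul_zero]
  · rw [eq_zero_of_odd_of_regular hS hreg hodd, eq_zero_of_odd_of_regular hS hreg hodd, mul_zero]

/-- **Two cluster points with the pure-power pair function agreeing at even orders `≥ 4` (hypothesis `h6`, the residue 6′)
agree at every order off the diagonals**: orders `0`, odd and `2` are free.
[folklore] -/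
theorem eqOn_of_ge_four {Δ : ℝ} {S₁ S₂ : CorrFamily 3} (hS₁ : IsClusterPoint S₁) (hS₂ : IsClusterPoint S₂)
    (h₁ : ∀ x ∈ NonCoincident 3 2, S₁ 2 x = ‖x 0 - x 1‖ ^ (-(2 * Δ)))
    (h₂ : ∀ x ∈ NonCoincident 3 2, S₂ 2 x = ‖x 0 - x 1‖ ^ (-(2 * Δ)))
    (h6 : ∀ m : ℕ, 2 ≤ m → (NonCoincident 3 (2 * m)).EqOn (S₁ (2 * m)) (S₂ (2 * m))) :
    ∀ n, (NonCoincident 3 n).EqOn (S₁ n) (S₂ n) := by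
  intro n x hx
  rcases Nat.even_or_odd n with ⟨m, hm⟩ | hodd
  · obtain rfl : n = 2 * m := by omega
    rcases Nat.lt_or_ge m 2 with hm2 | hm2
    · interval_cases m
      · exact (hS₁.orderZero_eq_one x).trans (hS₂.orderZero_eq_one x).symm
      · exact (h₁ x hx).trans (h₂ x hx).symm
    · exact h6 m hm2 hx
  · exact (hS₁.eq_zero_of_odd hodd hx).trans (hS₂.eq_zero_of_odd hodd hx).symm

/-! ## Proved glue -/

/-- The reference mesh sequence `1/(k+1) → 0⁺`. [folklore] -/
theorem refMesh_tendsto : Tendsto (fun k : ℕ => 1 / ((k : ℝ) + 1)) atTop (𝓝[>] (0 : ℝ)) := by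
  refine tendsto_nhdsWithin_iff.2 ⟨tendsto_one_div_add_atTop_nhds_zero_nat, ?_⟩
  refine Filter.Eventually.of_forall fun k => ?_
  show (0 : ℝ) < 1 / ((k : ℝ) + 1)
  positivity

/-! ## The two branches (card C2, and the interacting branch), kernel-checked -/

/-- **FREE BRANCH (card C2): if no regular cluster point is interacting, the pinned zoom converges to
`W_Δ`, which is non-degenerate and Möbius covariant — STUBS 1–4 only.** The reference cluster point
`S₀` (STUB 1 along `1/(k+1)`) equals `wickPower Δ` (STUB 3 + normalisation); every other regular
cluster point equals it off the diagonals (STUB 3 again), so the subsequence principle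
`hasPointwiseScalingLimit_of_seq_subseq` gives convergence along the full filter; non-degeneracy is
STUB 2, covariance STUB 4. [cite: AizenmanCDM2020, Prop. 7.2 and remark p. 23] -/
theorem pinnedLimit_of_allFree {Δ c : ℝ} (hc : 0 < c)
    (hG : Tendsto (fun y : Site 3 => criticalTwoPoint 3 y * Real.sqrt (∑ i, ((y i : ℝ)) ^ 2) ^ (2 * Δ))
      cofinite (𝓝 c))
    (hfree : ∀ S : CorrFamily 3, IsClusterPoint S → IsRegular S → ¬ HasNontrivialU4 S) :
    ∃ S, PinnedLimit Δ S := by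
  have h2 : ∀ S, IsClusterPoint S → ∀ x ∈ NonCoincident 3 2, S 2 x = ‖x 0 - x 1‖ ^ (-(2 * Δ)) :=
    stub_pinnedTwoPoint Δ c hc hG
  -- every regular cluster point is the Wick power family off the diagonals
  have hW : ∀ S, IsClusterPoint S → IsRegular S →
      ∀ n, ∀ x ∈ NonCoincident 3 n, S n x = wickPower Δ n x := by
    intro S hS hreg
    refine stub_freeClusterPointWick Δ S hS (h2 S hS) fun z hz => ?_
    by_contra hne
    exact hfree S hS hreg ⟨z, hz, hne⟩
  -- a reference cluster point, equal to `wickPower Δ` everywhere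
  obtain ⟨φ₀, S₀, hφ₀, hreg₀, hconv₀⟩ := pinnedZoom_compactness hc hG _ refMesh_tendsto
  have hS₀ : IsClusterPoint S₀ := isClusterPoint_of_subseq refMesh_tendsto hφ₀ hconv₀
  have hS₀W : S₀ = wickPower Δ := by
    funext n x
    by_cases hx : x ∈ NonCoincident 3 n
    · exact hW S₀ hS₀ hreg₀ n x hx
    · rw [hreg₀.1 n x hx, wickPower_of_not_mem hx]
  have hM₀ : IsMoebiusCovariant Δ S₀ := by
    rw [hS₀W]
    exact stub_wickPowerMoebius Δ
  refine ⟨S₀, ?_, isNondegenerateTwoPoint_of_twoPoint (h2 S₀ hS₀), hM₀⟩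
  refine hasPointwiseScalingLimit_of_seq_subseq fun n u hu => ?_
  obtain ⟨φ, S, hφ, hreg, hconv⟩ := pinnedZoom_compactness hc hG u hu
  have hS : IsClusterPoint S := isClusterPoint_of_subseq hu hφ hconv
  exact ⟨φ, hφ, (hconv n).congr_right fun x hx => by
    rw [hW S hS hreg n x hx, hW S₀ hS₀ hreg₀ n x hx]⟩

/-- **INTERACTING BRANCH: an interacting regular cluster point attracts the whole pinned zoom and is
inversion covariant, hence a witness of the crux — STUBS 1′, 2, 5, 6 and the standing disprover's
reduction `moebiusLimit_iff_inversion` (`Negative/CruxInversionOnly.lean`: translations, `O(3)` and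
dilations of a non-degenerate limit of `criticalCorr 3` are FREE given inversion covariance), so that NO
word lemma / item stmt-4726 is needed any more (reshape 2026-08-16).** The conclusion is the crux's
definiens, spelled out (only `MoebiusLimitExists_of` / `MoebiusLimit_of` conclude the crux by name).
[cite: DuminilCopinICM2022, §8.1 p. 25] -/
theorem witness_of_interacting {Δ c : ℝ} (hc : 0 < c)
    (hG : Tendsto (fun y : Site 3 => criticalTwoPoint 3 y * Real.sqrt (∑ i, ((y i : ℝ)) ^ 2) ^ (2 * Δ))
      cofinite (𝓝 c))
    {S₁ : CorrFamily 3} (hS₁ : IsClusterPoint S₁) (hreg₁ : IsRegular S₁)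
    (h5 : ∀ m : ℕ, 2 ≤ m → ∀ x : Fin (2 * m) → EuclideanSpace ℝ (Fin 3), x ∈ NonCoincident 3 (2 * m) →
      (∀ i, x i ≠ 0) →
      S₁ (2 * m) (fun i => EuclideanGeometry.inversion 0 1 (x i)) = (∏ i, ‖x i‖ ^ (2 * Δ)) * S₁ (2 * m) x)
    (h6 : ∀ S₂ : CorrFamily 3, IsClusterPoint S₂ → IsRegular S₂ →
      (∀ x ∈ NonCoincident 3 2, S₂ 2 x = ‖x 0 - x 1‖ ^ (-(2 * Δ))) →
      ∀ m : ℕ, 2 ≤ m → (NonCoincident 3 (2 * m)).EqOn (S₁ (2 * m)) (S₂ (2 * m))) :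
    ∃ (ρ : ℝ → ℝ) (Δ' : ℝ) (S' : CorrFamily 3), (∀ δ ∈ Set.Ioc (0:ℝ) 1, 0 < ρ δ) ∧ 0 < Δ' ∧
      HasPointwiseScalingLimit (criticalCorr 3) ρ S' ∧ IsNondegenerateTwoPoint S' ∧
        IsMoebiusCovariant Δ' S' := by
  have h2 : ∀ S, IsClusterPoint S → ∀ x ∈ NonCoincident 3 2, S 2 x = ‖x 0 - x 1‖ ^ (-(2 * Δ)) :=
    stub_pinnedTwoPoint Δ c hc hG
  have hinv : IsInversionCovariant Δ S₁ :=
    isInversionCovariant_of_ge_four hS₁ hreg₁ (h2 S₁ hS₁) h5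
  have hlim : HasPointwiseScalingLimit (criticalCorr 3) rhoPin S₁ := by
    refine hasPointwiseScalingLimit_of_seq_subseq fun n u hu => ?_
    obtain ⟨φ, S, hφ, hreg, hconv⟩ := pinnedZoom_compactness hc hG u hu
    have hS : IsClusterPoint S := isClusterPoint_of_subseq hu hφ hconv
    exact ⟨φ, hφ, (hconv n).congr_right fun x hx =>
      (eqOn_of_ge_four hS₁ hS (h2 S₁ hS₁) (h2 S hS) (h6 S hS hreg (h2 S hS)) n hx).symm⟩
  exact MoebiusLimitExistsNegative.moebiusLimit_iff_inversion.2
    ⟨rhoPin, Δ, S₁, rhoPin_pos, hlim, isNondegenerateTwoPoint_of_twoPoint (h2 S₁ hS₁), hinv⟩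

/-- A pinned limit gives a WITNESS of the crux (the crux's definiens, spelled out — so that only
`MoebiusLimitExists_of` / `MoebiusLimit_of` conclude the crux BY NAME): `ρ_pin > 0` (`rhoPin_pos`)
and `0 < Δ` is REDUNDANT (landed `Negative/DeltaWindow.lean`: `moebiusLimit_iff_without_delta_pos`,
`Δ ∈ [1/2, 1]` forced by the infrared and Simon–Lieb bounds). [cite: Simon1980, Thm. 1] -/
theorem witness_of_pinnedLimit {Δ : ℝ} {S : CorrFamily 3} (h : PinnedLimit Δ S) :
    ∃ (ρ : ℝ → ℝ) (Δ' : ℝ) (S' : CorrFamily 3), (∀ δ ∈ Set.Ioc (0:ℝ) 1, 0 < ρ δ) ∧ 0 < Δ' ∧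
      HasPointwiseScalingLimit (criticalCorr 3) ρ S' ∧ IsNondegenerateTwoPoint S' ∧
        IsMoebiusCovariant Δ' S' :=
  MoebiusLimitExistsNegative.moebiusLimit_iff_without_delta_pos.2
    ⟨rhoPin, Δ, S, rhoPin_pos, h.1, h.2.1, h.2.2⟩

/-- **Card C3 — FAILURE OF THE CRUX CERTIFIES INTERACTION (kernel-checked modulo STUBS 1–4 only).**
Given the two-point law (item 0634), if the crux fails then some regular cluster point of the pinned
zoom has a non-trivial connected four-point function: an interacting subsequential scaling limit of
the 3D critical Ising correlators exists. [cite: AizenmanCDM2020, Prop. 7.2 and remark p. 23] -/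
theorem interacting_clusterPoint_of_not_crux
    (h2pt : Summit.CriticalPhenomena.Ising3DConformalLimit.Theses.IsingEuclidUpgrade.IsingEuclidUpgradeR2RotInvPowerLaw)
    (hnot : ¬ Summit.CriticalPhenomena.Ising3DConformalLimit.Theses.EnergyNotSigmaSquared.MoebiusLimit) :
    ∃ S : CorrFamily 3, IsClusterPoint S ∧ IsRegular S ∧ HasNontrivialU4 S := by
  obtain ⟨Δ, c, hc, hG⟩ := h2pt
  by_contra h
  push Not at h
  obtain ⟨S, hS⟩ := pinnedLimit_of_allFree hc hG h
  exact hnot (witness_of_pinnedLimit hS)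

/-! ## The reduction: item 0634 + the two residues 5′/6′ ⇒ the crux -/

/-- **THE REDUCTION OF THE CRUX (given the two-point law) TO ITS TWO CRUX-SIZED RESIDUES.** If (5′) every
interacting regular cluster point of the pinned zoom with the pure-power pair function is inversion covariant at the even
orders `≥ 4` off the diagonals and the origin, and (6′) such a cluster point agrees at the even orders `≥ 4` with every
regular cluster point having the same pair function, then `MoebiusLimitExists` holds — unconditionally in everything else
(compactness, the free branch, translations/rotations/dilations, `0 < Δ` are theorems). The converse implications
crux ⇒ 5′, crux ⇒ 6′ are the refuter's `ResiduesTight.residues_of_crux` (Theorems/MoebiusLimitExists/Negative/ResiduesTight.lean),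
so that, given item 0634, the crux is EQUIVALENT to the conjunction of its two residues. Case split on whether some regular
cluster point is interacting: `witness_of_interacting`, else `pinnedLimit_of_allFree` and `witness_of_pinnedLimit`.
[cite: DuminilCopinICM2022, §8.1 eq. (8.1)–(8.2) and §8.4 p. 29] -/
theorem MoebiusLimitExists_of_residues
    (h2pt : Summit.CriticalPhenomena.Ising3DConformalLimit.Theses.IsingEuclidUpgrade.IsingEuclidUpgradeR2RotInvPowerLaw)
    (h5 : ∀ (Δ : ℝ) (S : CorrFamily 3), IsClusterPoint S → IsRegular S →
      (∀ x ∈ NonCoincident 3 2, S 2 x = ‖x 0 - x 1‖ ^ (-(2 * Δ))) →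
      HasNontrivialU4 S →
      ∀ m : ℕ, 2 ≤ m → ∀ x : Fin (2 * m) → EuclideanSpace ℝ (Fin 3), x ∈ NonCoincident 3 (2 * m) →
        (∀ i, x i ≠ 0) →
        S (2 * m) (fun i => EuclideanGeometry.inversion 0 1 (x i)) =
          (∏ i, ‖x i‖ ^ (2 * Δ)) * S (2 * m) x)
    (h6 : ∀ (Δ : ℝ) (S₁ S₂ : CorrFamily 3), IsClusterPoint S₁ → IsClusterPoint S₂ →
      IsRegular S₁ → IsRegular S₂ →
      (∀ x ∈ NonCoincident 3 2, S₁ 2 x = ‖x 0 - x 1‖ ^ (-(2 * Δ))) →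
      (∀ x ∈ NonCoincident 3 2, S₂ 2 x = ‖x 0 - x 1‖ ^ (-(2 * Δ))) →
      HasNontrivialU4 S₁ → ∀ m : ℕ, 2 ≤ m → (NonCoincident 3 (2 * m)).EqOn (S₁ (2 * m)) (S₂ (2 * m))) :
    Summit.CriticalPhenomena.Ising3DConformalLimit.Theses.PerfectScreening.MoebiusLimitExists := by
  obtain ⟨Δ, c, hc, hG⟩ := h2pt
  by_cases hint : ∃ S₁ : CorrFamily 3, IsClusterPoint S₁ ∧ IsRegular S₁ ∧ HasNontrivialU4 S₁
  · obtain ⟨S₁, hS₁, hreg₁, hU₁⟩ := hint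
    have h2 := stub_pinnedTwoPoint Δ c hc hG S₁ hS₁
    exact witness_of_interacting hc hG hS₁ hreg₁ (h5 Δ S₁ hS₁ hreg₁ h2 hU₁)
      fun S₂ hS₂ hreg₂ h2' => h6 Δ S₁ S₂ hS₁ hS₂ hreg₁ hreg₂ h2 h2' hU₁
  · push Not at hint
    obtain ⟨S, hS⟩ := pinnedLimit_of_allFree hc hG hint
    exact witness_of_pinnedLimit hS


/-! ### The realised branch: an interacting regular cluster point that pins the zoom IS the full pinned limit -/

/-- **6′ realises the limit**: under the two-point law, an interacting regular cluster point `S₁` which agrees at the even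
orders `≥ 4` with every regular cluster point having the same pure-power pair function IS the full pinned limit,
`HasPointwiseScalingLimit (criticalCorr 3) rhoPin S₁` (STUB 1 compactness + the subsequence principle; orders `0`, odd, `2`
are free, `eqOn_of_ge_four`). [cite: DuminilCopinICM2022, §8.4 p. 29] -/
theorem hasLimit_of_residue6 {Δ c : ℝ} (hc : 0 < c)
    (hG : Tendsto (fun y : Site 3 => criticalTwoPoint 3 y * Real.sqrt (∑ i, ((y i : ℝ)) ^ 2) ^ (2 * Δ))
      cofinite (𝓝 c))
    {S₁ : CorrFamily 3} (hS₁ : IsClusterPoint S₁)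
    (h6 : ∀ S₂ : CorrFamily 3, IsClusterPoint S₂ → IsRegular S₂ →
      (∀ x ∈ NonCoincident 3 2, S₂ 2 x = ‖x 0 - x 1‖ ^ (-(2 * Δ))) →
      ∀ m : ℕ, 2 ≤ m → (NonCoincident 3 (2 * m)).EqOn (S₁ (2 * m)) (S₂ (2 * m))) :
    HasPointwiseScalingLimit (criticalCorr 3) rhoPin S₁ := by
  have h2 : ∀ S, IsClusterPoint S → ∀ x ∈ NonCoincident 3 2, S 2 x = ‖x 0 - x 1‖ ^ (-(2 * Δ)) :=
    stub_pinnedTwoPoint Δ c hc hG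
  refine hasPointwiseScalingLimit_of_seq_subseq fun n u hu => ?_
  obtain ⟨φ, S, hφ, hreg, hconv⟩ := pinnedZoom_compactness hc hG u hu
  have hS : IsClusterPoint S := isClusterPoint_of_subseq hu hφ hconv
  exact ⟨φ, hφ, (hconv n).congr_right fun x hx =>
    (eqOn_of_ge_four hS₁ hS (h2 S₁ hS₁) (h2 S hS) (h6 S hS hreg (h2 S hS)) n hx).symm⟩

/-- **Rotation invariance of a regular cluster point from its even orders `≥ 4`**: orders `0` (both sides `1`), odd
(both sides `0`), `2` (the pure power is radial, `‖R p − R q‖ = ‖p − q‖`) and coincident configurations (both sides `0`,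
`R` being injective) are free. [folklore] -/
theorem isRotationInvariant_of_ge_four {Δ : ℝ} {S : CorrFamily 3} (hS : IsClusterPoint S)
    (hreg : IsRegular S) (h2 : ∀ x ∈ NonCoincident 3 2, S 2 x = ‖x 0 - x 1‖ ^ (-(2 * Δ)))
    (h5r : ∀ m : ℕ, 2 ≤ m → ∀ (R : EuclideanSpace ℝ (Fin 3) ≃ₗᵢ[ℝ] EuclideanSpace ℝ (Fin 3)),
      ∀ x ∈ NonCoincident 3 (2 * m), S (2 * m) (fun i => R (x i)) = S (2 * m) x) :
    IsRotationInvariant S := by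
  intro n R x
  have hiff : (fun i => R (x i)) ∈ NonCoincident 3 n ↔ x ∈ NonCoincident 3 n := by
    rw [mem_nonCoincident, mem_nonCoincident]
    exact R.injective.of_comp_iff x
  rcases Nat.even_or_odd n with ⟨m, hm⟩ | hodd
  · obtain rfl : n = 2 * m := by omega
    by_cases hx : x ∈ NonCoincident 3 (2 * m)
    · rcases Nat.lt_or_ge m 2 with hm2 | hm2
      · interval_cases m
        · rw [hS.orderZero_eq_one, hS.orderZero_eq_one]
        · rw [h2 _ (hiff.2 hx), h2 _ hx, ← map_sub, LinearIsometryEquiv.norm_map]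
      · exact h5r m hm2 R x hx
    · rw [hreg.1 _ _ (mt hiff.1 hx), hreg.1 _ _ hx]
  · rw [eq_zero_of_odd_of_regular hS hreg hodd, eq_zero_of_odd_of_regular hS hreg hodd]

/-- A full pinned limit is a cluster point of the pinned zoom (along the reference meshes `1/(k+1)`). [folklore] -/
theorem isClusterPoint_of_hasLimit {S : CorrFamily 3} (h : HasPointwiseScalingLimit (criticalCorr 3) rhoPin S) :
    IsClusterPoint S := by
  refine ⟨fun k : ℕ => 1 / ((k : ℝ) + 1), refMesh_tendsto, fun n => ?_⟩
  intro v hv x hx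
  obtain ⟨t, ht, hev⟩ := h n v hv x hx
  exact ⟨t, ht, refMesh_tendsto.eventually hev⟩

open Classical in
/-- A normalised family equals its normalisation. [folklore] -/
theorem normalise_eq_self_of_isNormalised {S : CorrFamily 3} (hS : IsNormalised S) :
    (fun n x => if x ∈ NonCoincident 3 n then S n x else 0) = S := by
  funext n x
  by_cases hx : x ∈ NonCoincident 3 n
  · rw [if_pos hx]
  · rw [if_neg hx, hS n x hx]

/-- **Scale covariance of a regular full pinned limit with pure-power pair law, with THE exponent of the pair law**:
dilation covariance with some `Δ'` is automatic for any non-degenerate limit (`exists_scaleCovariant_normalised`,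
Messager–Miracle-Solé + Cauchy), and `Δ' = Δ` is read off the pairs `(0,e₀)`, `(0,2e₀)` (`delta_eq_of_clusterPoint`).
[cite: FrancescoMathieuSenechal1997, §4.3.1 eq. (4.55)] -/
theorem isScaleCovariant_of_hasLimit_regular {Δ : ℝ} {S : CorrFamily 3}
    (hlim : HasPointwiseScalingLimit (criticalCorr 3) rhoPin S) (hreg : IsRegular S)
    (h2 : ∀ x ∈ NonCoincident 3 2, S 2 x = ‖x 0 - x 1‖ ^ (-(2 * Δ))) : IsScaleCovariant Δ S := by
  have hnd : IsNondegenerateTwoPoint S := isNondegenerateTwoPoint_of_twoPoint h2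
  obtain ⟨Δ', -, hsc⟩ := MoebiusLimitExistsNegative.exists_scaleCovariant_normalised rhoPin_pos hlim hnd
  rw [normalise_eq_self_of_isNormalised hreg.1] at hsc
  have hΔ : Δ = Δ' :=
    PinnedClusterPoints.delta_eq_of_clusterPoint rhoPin_pos hlim hnd hsc (isClusterPoint_of_hasLimit hlim) h2
  rwa [hΔ]

/-! ## THE THREE REGISTERED RESIDUES (skeleton v9 = lead c3's v8 shape; signatures verbatim as registered 15:58Z)

On the REALISED branch — the full pinned limit that 6′ attaches to an interacting regular cluster point
(`hasLimit_of_residue6`) — the former monolithic residue 5′ `stub_interactingInversion_ge_four` splits along its classical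
seam into 5′r (the `O(3)` upgrade) and 5′i (the inversion upgrade of an `O(3)`-invariant limit). Each of 6′, 5′r, 5′i is
implied VERBATIM by one existing crux item of route `HyperoctahedralRP` (dictionary below, kernel-checked) and by the crux
(`Negative/ResiduesTight.lean`, `Negative/PinnedClusterPoints.lean`); none is claimed provable here — they are the open
3D-Ising-CFT conjecture split three ways (existence / rotations / inversion: Duminil-Copin ICM 2022 §8.4). Item 0634
`IsingEuclidUpgradeR2RotInvPowerLaw` is the first hypothesis of each, BY NAME (it puts the line's 0634-toolkit — compactness,
pure-power pair law of cluster points, local bounds — at the prover's disposal). -/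

/-- **STUB 5′r — `O(3)` INVARIANCE OF AN INTERACTING REGULAR FULL PINNED LIMIT AT EVEN ORDERS `≥ 4`** (open; = crux
item stmt-1980 `LimitRotationInvariant` on the realised branch, `stub_realisedRotation_of_item1980`; its exact residue there
is the `UnitSigmaBound` of the 1980 line, lead c3's worker). Orders `0`, odd, `2` and coincident configurations are free
(`isRotationInvariant_of_ge_four`). Why it might fail: beyond `n = 2` no theorem turns OS positivity in the nine cubic time
directions + scale covariance into `O(3)` covariance; rotation invariance on `ℤ³` is a postulate (ICM 2022 §8.1 p. 25), a
theorem only in `d = 2`. [cite: DuminilCopinICM2022, §8.1 p. 25 and §8.4 p. 29] -/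
theorem stub_realisedRotation :
    Summit.CriticalPhenomena.Ising3DConformalLimit.Theses.IsingEuclidUpgrade.IsingEuclidUpgradeR2RotInvPowerLaw →
      ∀ (Δ : ℝ) (S : CorrFamily 3), HasPointwiseScalingLimit (criticalCorr 3) rhoPin S → IsRegular S →
        (∀ x ∈ NonCoincident 3 2, S 2 x = ‖x 0 - x 1‖ ^ (-(2 * Δ))) → HasNontrivialU4 S →
          ∀ m : ℕ, 2 ≤ m → ∀ (R : EuclideanSpace ℝ (Fin 3) ≃ₗᵢ[ℝ] EuclideanSpace ℝ (Fin 3)),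
            ∀ x ∈ NonCoincident 3 (2 * m), S (2 * m) (fun i => R (x i)) = S (2 * m) x := by
  sorry

/-- **STUB 5′i — THE INVERSION IDENTITY AT EVEN ORDERS `≥ 4` FOR AN `O(3)`-INVARIANT INTERACTING REGULAR FULL PINNED
LIMIT** (open, the HARDEST stub; = crux item stmt-1982 `InversionUpgradeNormalised` on the realised branch,
`stub_realisedInversion_of_item1982` — Polyakov's upgrade scale ⇒ conformal for the 3D Ising limit). What does NOT
suffice: every closed inherited constraint (Euclid, exact scale covariance, RP in all planes, GKS/Lebowitz signs, pairing
bounds) is passed by non-Möbius families (`ScaleCovarianceNotMoebius_holds`); the statement is false without the lattice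
provenance (`Negative/StubsWithoutLattice.lean`). [cite: PolandRychkovVichi2019, §II eq. (2)] [cite: Polyakov1970]
[cite: DuminilCopinICM2022, §8.4 p. 29] -/
theorem stub_realisedInversion_ge_four :
    Summit.CriticalPhenomena.Ising3DConformalLimit.Theses.IsingEuclidUpgrade.IsingEuclidUpgradeR2RotInvPowerLaw →
      ∀ (Δ : ℝ) (S : CorrFamily 3), HasPointwiseScalingLimit (criticalCorr 3) rhoPin S → IsRegular S →
        (∀ x ∈ NonCoincident 3 2, S 2 x = ‖x 0 - x 1‖ ^ (-(2 * Δ))) → HasNontrivialU4 S → IsRotationInvariant S →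
          ∀ m : ℕ, 2 ≤ m → ∀ x : Fin (2 * m) → EuclideanSpace ℝ (Fin 3), x ∈ NonCoincident 3 (2 * m) →
            (∀ i, x i ≠ 0) →
            S (2 * m) (fun i => EuclideanGeometry.inversion 0 1 (x i)) = (∏ i, ‖x i‖ ^ (2 * Δ)) * S (2 * m) x := by
  sorry

/-- **STUB 6′ — UNIQUENESS ANCHORED AT AN INTERACTING CLUSTER POINT, AT EVEN ORDERS `≥ 4`** (open; ⟺ crux item
stmt-1981 `ExistsScaleCovariantLimit` under 0634: `⇐` is `stub_interactingUnique_of_item1981` below, `⇒` is the landed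
`existsScaleCovariantLimit_iff_residue6_cpt`, …ResidueDictionary.lean). If a regular cluster point `S₁` of the pinned zoom is
interacting, then every regular cluster point `S₂` with the same pure-power two-point function agrees with `S₁` on the
non-coincident `2m`-point configurations, `m ≥ 2`: interacting cluster points do not DRIFT, and free and interacting cluster
points do not COEXIST. FALSE without `IsClusterPoint` even inside {Möbius covariant, Lebowitz, GKS II}
(`Negative/MoebiusDecoys.lean`). [cite: DuminilCopinICM2022, §8.4 p. 29] -/
theorem stub_interactingUnique_ge_four :
    Summit.CriticalPhenomena.Ising3DConformalLimit.Theses.IsingEuclidUpgrade.IsingEuclidUpgradeR2RotInvPowerLaw →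
      ∀ (Δ : ℝ) (S₁ S₂ : CorrFamily 3), IsClusterPoint S₁ → IsClusterPoint S₂ → IsRegular S₁ → IsRegular S₂ →
        (∀ x ∈ NonCoincident 3 2, S₁ 2 x = ‖x 0 - x 1‖ ^ (-(2 * Δ))) →
        (∀ x ∈ NonCoincident 3 2, S₂ 2 x = ‖x 0 - x 1‖ ^ (-(2 * Δ))) →
          HasNontrivialU4 S₁ → ∀ m : ℕ, 2 ≤ m → (NonCoincident 3 (2 * m)).EqOn (S₁ (2 * m)) (S₂ (2 * m)) := by
  sorry

/-! ## Dictionary (kernel-checked): each residue is implied VERBATIM by one existing crux item -/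

/-- **6′ ⟸ item stmt-1981** `ExistsScaleCovariantLimit`: under a full-filter non-degenerate limit ALL cluster points of the
pinned zoom coincide off the diagonals (`PinnedClusterPoints.clusterPoint_eq`); no use of 0634, regularity or interaction.
[cite: DuminilCopinICM2022, §8.4 p. 29] -/
theorem stub_interactingUnique_of_item1981
    (h1981 : Summit.CriticalPhenomena.Ising3DConformalLimit.Theses.HyperoctahedralRP.ExistsScaleCovariantLimit) :
    Summit.CriticalPhenomena.Ising3DConformalLimit.Theses.IsingEuclidUpgrade.IsingEuclidUpgradeR2RotInvPowerLaw →
      ∀ (Δ : ℝ) (S₁ S₂ : CorrFamily 3), IsClusterPoint S₁ → IsClusterPoint S₂ → IsRegular S₁ → IsRegular S₂ →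
        (∀ x ∈ NonCoincident 3 2, S₁ 2 x = ‖x 0 - x 1‖ ^ (-(2 * Δ))) →
        (∀ x ∈ NonCoincident 3 2, S₂ 2 x = ‖x 0 - x 1‖ ^ (-(2 * Δ))) →
          HasNontrivialU4 S₁ → ∀ m : ℕ, 2 ≤ m → (NonCoincident 3 (2 * m)).EqOn (S₁ (2 * m)) (S₂ (2 * m)) := by
  intro _ Δ S₁ S₂ hS₁ hS₂ _ _ _ _ _ m _ x hx
  obtain ⟨ρ, Δ', S', hρ, -, hlim, -, hnd, -⟩ := h1981
  rw [PinnedClusterPoints.clusterPoint_eq hρ hlim hnd hS₁ hx, PinnedClusterPoints.clusterPoint_eq hρ hlim hnd hS₂ hx]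

/-- **5′r ⟸ item stmt-1980** `LimitRotationInvariant` (whose hypothesis `HRP2Rigidity`, item stmt-1979, is the tree
theorem `HRP2Rigidity_of`): a regular full pinned limit is normalised, non-degenerate (pure power), translation invariant
and scale covariant (`isScaleCovariant_of_hasLimit_regular`), so 1980 makes it `O(3)` invariant at every order.
[cite: DuminilCopinICM2022, §8.1 p. 25] -/
theorem stub_realisedRotation_of_item1980
    (h1980 : Summit.CriticalPhenomena.Ising3DConformalLimit.Theses.HyperoctahedralRP.LimitRotationInvariant) :
    Summit.CriticalPhenomena.Ising3DConformalLimit.Theses.IsingEuclidUpgrade.IsingEuclidUpgradeR2RotInvPowerLaw →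
      ∀ (Δ : ℝ) (S : CorrFamily 3), HasPointwiseScalingLimit (criticalCorr 3) rhoPin S → IsRegular S →
        (∀ x ∈ NonCoincident 3 2, S 2 x = ‖x 0 - x 1‖ ^ (-(2 * Δ))) → HasNontrivialU4 S →
          ∀ m : ℕ, 2 ≤ m → ∀ (R : EuclideanSpace ℝ (Fin 3) ≃ₗᵢ[ℝ] EuclideanSpace ℝ (Fin 3)),
            ∀ x ∈ NonCoincident 3 (2 * m), S (2 * m) (fun i => R (x i)) = S (2 * m) x := by
  intro _ Δ S hlim hreg h2 _ m _ R x _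
  exact h1980 _root_.Summit.CriticalPhenomena.Ising3DConformalLimit.Cruxes.HRP2Rigidity.XRayMellin.HRP2Rigidity_of
    rhoPin Δ S rhoPin_pos hlim hreg.1 (isNondegenerateTwoPoint_of_twoPoint h2) hreg.2.2
    (isScaleCovariant_of_hasLimit_regular hlim hreg h2) (2 * m) R x

/-- **5′i ⟸ item stmt-1982** `InversionUpgradeNormalised`: an `O(3)`-invariant regular full pinned limit with pure-power
pair law is normalised, non-degenerate, Euclidean invariant and scale covariant with the pair law's `Δ`
(`isScaleCovariant_of_hasLimit_regular`), so 1982 makes it inversion covariant with that `Δ`. [cite: Polyakov1970]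
[cite: DuminilCopinICM2022, §8.4 p. 29] -/
theorem stub_realisedInversion_of_item1982
    (h1982 : Summit.CriticalPhenomena.Ising3DConformalLimit.Theses.HyperoctahedralRP.InversionUpgradeNormalised) :
    Summit.CriticalPhenomena.Ising3DConformalLimit.Theses.IsingEuclidUpgrade.IsingEuclidUpgradeR2RotInvPowerLaw →
      ∀ (Δ : ℝ) (S : CorrFamily 3), HasPointwiseScalingLimit (criticalCorr 3) rhoPin S → IsRegular S →
        (∀ x ∈ NonCoincident 3 2, S 2 x = ‖x 0 - x 1‖ ^ (-(2 * Δ))) → HasNontrivialU4 S → IsRotationInvariant S →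
          ∀ m : ℕ, 2 ≤ m → ∀ x : Fin (2 * m) → EuclideanSpace ℝ (Fin 3), x ∈ NonCoincident 3 (2 * m) →
            (∀ i, x i ≠ 0) →
            S (2 * m) (fun i => EuclideanGeometry.inversion 0 1 (x i)) = (∏ i, ‖x i‖ ^ (2 * Δ)) * S (2 * m) x := by
  intro _ Δ S hlim hreg h2 _ hrot m _ x _ hx0
  exact h1982 rhoPin Δ S rhoPin_pos hlim hreg.1 (isNondegenerateTwoPoint_of_twoPoint h2) ⟨hreg.2.2, hrot⟩
    (isScaleCovariant_of_hasLimit_regular hlim hreg h2) (2 * m) x hx0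

/-! ## The reshape 5′ = 6′ + 5′r + 5′i on the realised branch (kernel-checked glue) -/

/-- **The former residue 5′ `stub_interactingInversion_ge_four` from 6′, 5′r, 5′i.** Given the two-point law, an
interacting regular cluster point `S` with pure-power pair law (exponent `Δ`; the law also holds with 0634's exponent, so the
two exponents serve interchangeably) IS the full pinned limit by 6′ (`hasLimit_of_residue6`), is `O(3)` invariant by 5′r
(`isRotationInvariant_of_ge_four`), and then satisfies the inversion identity by 5′i. [cite: DuminilCopinICM2022, §8.4 p. 29] -/
theorem interactingInversion_ge_four_of_realised
    (h2pt : Summit.CriticalPhenomena.Ising3DConformalLimit.Theses.IsingEuclidUpgrade.IsingEuclidUpgradeR2RotInvPowerLaw)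
    (h6 : ∀ (Δ : ℝ) (S₁ S₂ : CorrFamily 3), IsClusterPoint S₁ → IsClusterPoint S₂ → IsRegular S₁ → IsRegular S₂ →
        (∀ x ∈ NonCoincident 3 2, S₁ 2 x = ‖x 0 - x 1‖ ^ (-(2 * Δ))) →
        (∀ x ∈ NonCoincident 3 2, S₂ 2 x = ‖x 0 - x 1‖ ^ (-(2 * Δ))) →
          HasNontrivialU4 S₁ → ∀ m : ℕ, 2 ≤ m → (NonCoincident 3 (2 * m)).EqOn (S₁ (2 * m)) (S₂ (2 * m)))
    (h5r : ∀ (Δ : ℝ) (S : CorrFamily 3), HasPointwiseScalingLimit (criticalCorr 3) rhoPin S → IsRegular S →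
        (∀ x ∈ NonCoincident 3 2, S 2 x = ‖x 0 - x 1‖ ^ (-(2 * Δ))) → HasNontrivialU4 S →
          ∀ m : ℕ, 2 ≤ m → ∀ (R : EuclideanSpace ℝ (Fin 3) ≃ₗᵢ[ℝ] EuclideanSpace ℝ (Fin 3)),
            ∀ x ∈ NonCoincident 3 (2 * m), S (2 * m) (fun i => R (x i)) = S (2 * m) x)
    (h5i : ∀ (Δ : ℝ) (S : CorrFamily 3), HasPointwiseScalingLimit (criticalCorr 3) rhoPin S → IsRegular S →
        (∀ x ∈ NonCoincident 3 2, S 2 x = ‖x 0 - x 1‖ ^ (-(2 * Δ))) → HasNontrivialU4 S → IsRotationInvariant S →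
          ∀ m : ℕ, 2 ≤ m → ∀ x : Fin (2 * m) → EuclideanSpace ℝ (Fin 3), x ∈ NonCoincident 3 (2 * m) →
            (∀ i, x i ≠ 0) →
            S (2 * m) (fun i => EuclideanGeometry.inversion 0 1 (x i)) = (∏ i, ‖x i‖ ^ (2 * Δ)) * S (2 * m) x) :
    ∀ (Δ : ℝ) (S : CorrFamily 3), IsClusterPoint S → IsRegular S →
      (∀ x ∈ NonCoincident 3 2, S 2 x = ‖x 0 - x 1‖ ^ (-(2 * Δ))) →
      HasNontrivialU4 S →
      ∀ m : ℕ, 2 ≤ m → ∀ x : Fin (2 * m) → EuclideanSpace ℝ (Fin 3), x ∈ NonCoincident 3 (2 * m) →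
        (∀ i, x i ≠ 0) →
        S (2 * m) (fun i => EuclideanGeometry.inversion 0 1 (x i)) =
          (∏ i, ‖x i‖ ^ (2 * Δ)) * S (2 * m) x := by
  obtain ⟨Δ₀, c, hc, hG⟩ := h2pt
  intro Δ S hS hreg h2 hU m hm x hx hx0
  -- the pair law also holds with 0634's exponent `Δ₀` (STUB 2), which is the exponent every cluster point carries
  have h2₀ : ∀ S', IsClusterPoint S' → ∀ x ∈ NonCoincident 3 2, S' 2 x = ‖x 0 - x 1‖ ^ (-(2 * Δ₀)) :=
    stub_pinnedTwoPoint Δ₀ c hc hG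
  -- 6′ at `Δ₀`: `S` is the full pinned limit
  have hlim : HasPointwiseScalingLimit (criticalCorr 3) rhoPin S :=
    hasLimit_of_residue6 hc hG hS fun S₂ hS₂ hreg₂ h2₂ => h6 Δ₀ S S₂ hS hS₂ hreg hreg₂ (h2₀ S hS) h2₂ hU
  -- 5′r: `O(3)` invariance at every order
  have hrot : IsRotationInvariant S :=
    isRotationInvariant_of_ge_four hS hreg h2 (h5r Δ S hlim hreg h2 hU)
  -- 5′i: the inversion identity
  exact h5i Δ S hlim hreg h2 hU hrot m hm x hx hx0

/-- **The former residue 5′, registered form** (theorem from the three v9 residues). [cite: DuminilCopinICM2022, §8.4 p. 29] -/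
theorem stub_interactingInversion_ge_four
    (h2pt : Summit.CriticalPhenomena.Ising3DConformalLimit.Theses.IsingEuclidUpgrade.IsingEuclidUpgradeR2RotInvPowerLaw) :
    ∀ (Δ : ℝ) (S : CorrFamily 3), IsClusterPoint S → IsRegular S →
      (∀ x ∈ NonCoincident 3 2, S 2 x = ‖x 0 - x 1‖ ^ (-(2 * Δ))) →
      HasNontrivialU4 S →
      ∀ m : ℕ, 2 ≤ m → ∀ x : Fin (2 * m) → EuclideanSpace ℝ (Fin 3), x ∈ NonCoincident 3 (2 * m) →
        (∀ i, x i ≠ 0) →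
        S (2 * m) (fun i => EuclideanGeometry.inversion 0 1 (x i)) =
          (∏ i, ‖x i‖ ^ (2 * Δ)) * S (2 * m) x :=
  interactingInversion_ge_four_of_realised h2pt (stub_interactingUnique_ge_four h2pt) (stub_realisedRotation h2pt)
    (stub_realisedInversion_ge_four h2pt)

/-! ## The composition: 0634 + 6′ + 5′r + 5′i ⇒ the crux, BY NAME -/

/-- **`MoebiusLimitExists` from the three residues and the two-point law (item stmt-0634, by name)** — THE SKELETON
THEOREM (v9): the reduction `MoebiusLimitExists_of_residues` (case split on whether some regular cluster point of the
pinned zoom is interacting — `witness_of_interacting`, else the free branch `pinnedLimit_of_allFree`) applied to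
5′ = 6′ + 5′r + 5′i (`stub_interactingInversion_ge_four`) and 6′; the three registered residues are the ONLY `sorry`s of
this file. [cite: DuminilCopinICM2022, §8.1 eq. (8.1)–(8.2) and §8.4 p. 29] -/
theorem MoebiusLimitExists_of
    (h2pt : Summit.CriticalPhenomena.Ising3DConformalLimit.Theses.IsingEuclidUpgrade.IsingEuclidUpgradeR2RotInvPowerLaw) :
    Summit.CriticalPhenomena.Ising3DConformalLimit.Theses.PerfectScreening.MoebiusLimitExists :=
  MoebiusLimitExists_of_residues h2pt (stub_interactingInversion_ge_four h2pt) (stub_interactingUnique_ge_four h2pt)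

/-- The same composition concluding the HOST-ROUTE spelling `EnergyNotSigmaSquared.MoebiusLimit`
(the two decls are one term; item stmt-CriticalPhenomena-1344). [folklore] -/
theorem MoebiusLimit_of
    (h2pt : Summit.CriticalPhenomena.Ising3DConformalLimit.Theses.IsingEuclidUpgrade.IsingEuclidUpgradeR2RotInvPowerLaw) :
    Summit.CriticalPhenomena.Ising3DConformalLimit.Theses.EnergyNotSigmaSquared.MoebiusLimit :=
  MoebiusLimitExists_of h2pt

/-- **SORRY-FREE COROLLARY: items 0634 ∧ 1981 ∧ 1980 ∧ 1982 ⇒ the crux THROUGH THE LINE** (dictionary + reshape +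
reduction). The direct assembly without 0634 and without the line, `MoebiusLimitExists_of_hrp`, and the exact factorisation
`MoebiusLimitExists_iff_hrp : MoebiusLimitExists ↔ 1981 ∧ 1980 ∧ 1982` are the tree file
`Theorems/EnergyNotSigmaSquaredMoebiusLimitExistsHrpFactorisation.lean` (lead c4). [cite: DuminilCopinICM2022, §8.4 p. 29] -/
theorem MoebiusLimitExists_of_items
    (h2pt : Summit.CriticalPhenomena.Ising3DConformalLimit.Theses.IsingEuclidUpgrade.IsingEuclidUpgradeR2RotInvPowerLaw)
    (h1981 : Summit.CriticalPhenomena.Ising3DConformalLimit.Theses.HyperoctahedralRP.ExistsScaleCovariantLimit)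
    (h1980 : Summit.CriticalPhenomena.Ising3DConformalLimit.Theses.HyperoctahedralRP.LimitRotationInvariant)
    (h1982 : Summit.CriticalPhenomena.Ising3DConformalLimit.Theses.HyperoctahedralRP.InversionUpgradeNormalised) :
    Summit.CriticalPhenomena.Ising3DConformalLimit.Theses.PerfectScreening.MoebiusLimitExists :=
  MoebiusLimitExists_of_residues h2pt
    (interactingInversion_ge_four_of_realised h2pt (stub_interactingUnique_of_item1981 h1981 h2pt)
      (stub_realisedRotation_of_item1980 h1980 h2pt) (stub_realisedInversion_of_item1982 h1982 h2pt))
    (stub_interactingUnique_of_item1981 h1981 h2pt)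

end Summit.CriticalPhenomena.Ising3DConformalLimit.MoebiusLimitExistsOnlyInteraction

end
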